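import Literature.Analysis.PDE.JetComposition
import Literature.Analysis.PDE.JetCutoff
import Literature.Analysis.PDE.SobolevIteratedFDeriv
import Literature.Analysis.PDE.SlabEnergyBounds
import Mathlib.Analysis.Calculus.FDeriv.Symmetric
import HarnessLib

/-!
# The flat energy estimate for the Picard source of a quasilinear system (topic `Analysis/PDE`)

Layer (III), step 5b (core), of the programme to prove short-time existence for quasilinear
strictly parabolic systems on a closed manifold (hypothesis `hQL` of
`Literature.Geometry.Riemannian.ricciFlow_shortTime_existence_of_quasilinear`). In a chart the
cut-off Picard source has the flat form

  `Θ♭(z)(y) = cut y • (Σᵢᵢ' Gᶜᵢᵢ'(y, 𝔷 y) • D²z(y) (Avᵢ) (Avᵢ') + Gʳ(y, 𝔷 y)) + g₀ y`,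
  `𝔷 = (z, Dz)`,

with globally smooth compactly supported coefficient functions `Gᶜ` (vanishing at zero jet) and
`Gʳ` (`JetCutoff.lean`), a fixed smooth compactly supported `g₀` and the compactly supported
unknown `z`. This file proves the two estimates of the frozen Picard scheme in the energy
currency of the linear theory:

* `energy_thetaFlat_le` — **boundedness form**: for every order `K` there is `C_top < ∞`, and
  for every bound `R` of the low derivatives of `z` there is `B < ∞`, with
  `E_K(Θ♭(z)) ≤ C_top δ² E_{K+2}(z) + B (1 + E_{K+1}(z))`, `δ` a bound of `|Gᶜ(y, 𝔷 y)|`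
  (small by the smallness of the jet), by the sharp high–low Leibniz bound and the composition
  estimates.

Auxiliary energy bookkeeping: energies of jet pairs (`sobolevEnergy_jetOf_le`), of the
operator-valued derivative (`sobolevEnergy_fderiv_le`, symmetry of second derivatives), of frame
components of the Hessian (`sobolevEnergy_hessComp_le`).

Everything is proved; no named fact and no `sorry` is introduced.

## References

* M. E. Taylor, *Partial Differential Equations III*, 2nd ed., Springer 2011, Ch. 15, §7
  (quasilinear parabolic systems: the iteration estimates). [TaylorPDEIII2011]
-/

noncomputable section

open MeasureTheory Set Function Filter
open scoped ENNReal ContDiff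

namespace Literature.Analysis.PDE

open Literature.Analysis.FunctionSpaces

variable {E' : Type*} [NormedAddCommGroup E'] [InnerProductSpace ℝ E'] [FiniteDimensional ℝ E']
  [MeasurableSpace E'] [BorelSpace E']
variable {W : Type*} [NormedAddCommGroup W] [InnerProductSpace ℝ W]

/-! ### Energies of jets and Hessians -/

/-- **The jet of a map**: `𝔷(y) = (z y, Dz y)`. [folklore] -/
def jetOf (z : E' → W) (y : E') : W × (E' →L[ℝ] W) := (z y, fderiv ℝ z y)

omit [FiniteDimensional ℝ E'] [MeasurableSpace E'] [BorelSpace E'] in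
/-- `jetOf_apply`: unfolding. [folklore] -/
@[simp] theorem jetOf_apply (z : E' → W) (y : E') : jetOf z y = (z y, fderiv ℝ z y) := rfl

omit [FiniteDimensional ℝ E'] [MeasurableSpace E'] [BorelSpace E'] in
/-- The jet of a smooth map is smooth. [folklore] -/
theorem contDiff_jetOf {z : E' → W} (hz : ContDiff ℝ ∞ z) : ContDiff ℝ ∞ (jetOf z) :=
  hz.prodMk (hz.fderiv_right (m := ∞) (by norm_cast))

omit [FiniteDimensional ℝ E'] [MeasurableSpace E'] [BorelSpace E'] in
/-- `‖(a, b)‖ₑ² ≤ ‖a‖ₑ² + ‖b‖ₑ²`. [folklore] -/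
theorem enorm_prod_sq_le {F G : Type*} [NormedAddCommGroup F] [NormedAddCommGroup G] (x : F × G) :
    ‖x‖ₑ ^ 2 ≤ ‖x.1‖ₑ ^ 2 + ‖x.2‖ₑ ^ 2 := by
  rw [← ofReal_norm, ← ofReal_norm, ← ofReal_norm, ← ENNReal.ofReal_pow (norm_nonneg _), ← ENNReal.ofReal_pow (norm_nonneg _),
    ← ENNReal.ofReal_pow (norm_nonneg _), ← ENNReal.ofReal_add (sq_nonneg _) (sq_nonneg _)]
  refine ENNReal.ofReal_le_ofReal ?_
  rw [Prod.norm_def]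
  rcases le_total ‖x.1‖ ‖x.2‖ with h | h
  · rw [max_eq_right h]; nlinarith [norm_nonneg x.1]
  · rw [max_eq_left h]; nlinarith [norm_nonneg x.2]

/-- **Energies of pairs**: `E_k(y ↦ (f y, g y)) ≤ E_k(f) + E_k(g)` for smooth maps. [folklore] -/
theorem sobolevEnergy_prodMk_le {F G : Type*} [NormedAddCommGroup F] [NormedSpace ℝ F] [NormedAddCommGroup G] [NormedSpace ℝ G] (k : ℕ) :
    ∀ {f : E' → F} {g : E' → G}, ContDiff ℝ ∞ f → ContDiff ℝ ∞ g →
      sobolevEnergy k (fun y ↦ (f y, g y)) ≤ sobolevEnergy k f + sobolevEnergy k g := by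
  induction k with
  | zero =>
    intro f g hf _
    simp only [sobolevEnergy_zero_left]
    have hm : AEMeasurable (fun y ↦ ‖f y‖ₑ ^ 2) volume := ((continuous_enorm.comp hf.continuous).measurable.pow_const 2).aemeasurable
    rw [← lintegral_add_left' hm]
    exact lintegral_mono fun y ↦ enorm_prod_sq_le (f y, g y)
  | succ k ih =>
    intro f g hf hg
    set e := stdOrthonormalBasis ℝ E' with he
    rw [sobolevEnergy_succ, sobolevEnergy_succ, sobolevEnergy_succ]
    have hm : AEMeasurable (fun y ↦ ‖f y‖ₑ ^ 2) volume := ((continuous_enorm.comp hf.continuous).measurable.pow_const 2).aemeasurable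
    have h0 : (∫⁻ y, ‖(f y, g y)‖ₑ ^ 2) ≤ (∫⁻ y, ‖f y‖ₑ ^ 2) + ∫⁻ y, ‖g y‖ₑ ^ 2 := by
      rw [← lintegral_add_left' hm]; exact lintegral_mono fun y ↦ enorm_prod_sq_le (f y, g y)
    have hfi : ∀ i, ContDiff ℝ ∞ fun y ↦ fderiv ℝ f y (e i) := fun i ↦ (hf.fderiv_right (m := ∞) (by norm_cast)).clm_apply contDiff_const
    have hgi : ∀ i, ContDiff ℝ ∞ fun y ↦ fderiv ℝ g y (e i) := fun i ↦ (hg.fderiv_right (m := ∞) (by norm_cast)).clm_apply contDiff_const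
    have hderiv : ∀ i, (fun y ↦ fderiv ℝ (fun y ↦ (f y, g y)) y (e i)) = fun y ↦ (fderiv ℝ f y (e i), fderiv ℝ g y (e i)) := by
      intro i; funext y
      rw [DifferentiableAt.fderiv_prodMk ((hf.differentiable (by simp)) y) ((hg.differentiable (by simp)) y)]
      rfl
    calc (∫⁻ y, ‖(f y, g y)‖ₑ ^ 2) + ∑ i, sobolevEnergy k (fun y ↦ fderiv ℝ (fun y ↦ (f y, g y)) y (e i))
        ≤ ((∫⁻ y, ‖f y‖ₑ ^ 2) + ∫⁻ y, ‖g y‖ₑ ^ 2) + ∑ i, (sobolevEnergy k (fun y ↦ fderiv ℝ f y (e i)) + sobolevEnergy k (fun y ↦ fderiv ℝ g y (e i))) := by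
          refine add_le_add h0 (Finset.sum_le_sum fun i _ ↦ ?_)
          rw [hderiv i]
          exact ih (hfi i) (hgi i)
      _ = _ := by rw [Finset.sum_add_distrib]; ring

/-- **Energies of the jet**: `E_k(𝔷) ≤ E_k(z) + E_k(Dz)`. [folklore] -/
theorem sobolevEnergy_jetOf_le (k : ℕ) {z : E' → W} (hz : ContDiff ℝ ∞ z) :
    sobolevEnergy k (jetOf z) ≤ sobolevEnergy k z + sobolevEnergy k (fderiv ℝ z) :=
  sobolevEnergy_prodMk_le k hz (hz.fderiv_right (m := ∞) (by norm_cast))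

omit [MeasurableSpace E'] [BorelSpace E'] in
/-- The operator norm through the frame (general normed codomain): `‖D‖² ≤ n Σᵢ ‖D bᵢ‖²`.
[folklore] -/
theorem opNorm_sq_le_sum' {V : Type*} [NormedAddCommGroup V] [NormedSpace ℝ V] (D : E' →L[ℝ] V) :
    ‖D‖ ^ 2 ≤ (Module.finrank ℝ E' : ℝ) * ∑ i, ‖D (stdOrthonormalBasis ℝ E' i)‖ ^ 2 := by
  set e := stdOrthonormalBasis ℝ E' with he
  set S := ∑ i, ‖D (e i)‖ ^ 2 with hS
  have hS0 : 0 ≤ S := Finset.sum_nonneg fun i _ ↦ sq_nonneg _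
  have hbound : ∀ x, ‖D x‖ ≤ Real.sqrt ((Module.finrank ℝ E' : ℝ) * S) * ‖x‖ := by
    intro x
    have hx : D x = ∑ i, (inner ℝ (e i) x) • D (e i) := by
      conv_lhs => rw [← e.sum_repr' x]
      rw [map_sum]; exact Finset.sum_congr rfl fun i _ ↦ by rw [map_smul]
    rw [hx]
    refine (norm_sum_le _ _).trans ?_
    have h1 : ∑ i, ‖(inner ℝ (e i) x) • D (e i)‖ = ∑ i, |inner ℝ (e i) x| * ‖D (e i)‖ := by
      refine Finset.sum_congr rfl fun i _ ↦ ?_; rw [norm_smul, Real.norm_eq_abs]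
    rw [h1]
    have hcs := Real.sum_mul_le_sqrt_mul_sqrt Finset.univ (fun i ↦ |inner ℝ (e i) x|) (fun i ↦ ‖D (e i)‖)
    refine hcs.trans ?_
    have hpar : ∑ i, |inner ℝ (e i) x| ^ 2 = ‖x‖ ^ 2 := by
      have h := e.sum_sq_norm_inner_left x
      simp only [Real.norm_eq_abs] at h ⊢
      simpa [sq_abs, real_inner_comm] using h
    rw [hpar, Real.sqrt_sq (norm_nonneg _), mul_comm]
    refine mul_le_mul_of_nonneg_right (Real.sqrt_le_sqrt ?_) (norm_nonneg _)
    rw [← hS]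
    rcases Nat.eq_zero_or_pos (Module.finrank ℝ E') with h0 | hpos
    · have : S = 0 := by
        rw [hS]; exact Finset.sum_eq_zero fun i _ ↦ absurd i.2 (by omega)
      simp [this]
    · exact le_mul_of_one_le_left hS0 (by exact_mod_cast hpos)
  have hop : ‖D‖ ≤ Real.sqrt ((Module.finrank ℝ E' : ℝ) * S) := ContinuousLinearMap.opNorm_le_bound _ (Real.sqrt_nonneg _) hbound
  calc ‖D‖ ^ 2 ≤ (Real.sqrt ((Module.finrank ℝ E' : ℝ) * S)) ^ 2 := pow_le_pow_left₀ (norm_nonneg _) hop 2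
    _ = (Module.finrank ℝ E' : ℝ) * S := Real.sq_sqrt (by positivity)

/-- **Energies of the operator-valued derivative**: for every `k` there is `C < ∞` (depending
on `k` and `dim E'`) with `E_k(Dz) ≤ C E_{k+1}(z)` for smooth `z` (symmetry of second
derivatives). [folklore] -/
theorem sobolevEnergy_fderiv_le {V : Type*} [NormedAddCommGroup V] [NormedSpace ℝ V] (k : ℕ) :
    ∃ C : ℝ≥0∞, C ≠ ⊤ ∧ ∀ {z : E' → V}, ContDiff ℝ ∞ z → sobolevEnergy k (fderiv ℝ z) ≤ C * sobolevEnergy (k + 1) z := by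
  set n : ℝ≥0∞ := (Module.finrank ℝ E' : ℝ≥0∞) with hn
  -- order zero: `∫ ‖Dz‖² ≤ n Σ_a ∫ ‖∂_a z‖² ≤ n E_1(z)`
  have h0 : ∀ {z : E' → V}, ContDiff ℝ ∞ z → (∫⁻ y, ‖fderiv ℝ z y‖ₑ ^ 2) ≤ n * sobolevEnergy 1 z := by
    intro z hz
    set e := stdOrthonormalBasis ℝ E' with he
    have hpt : ∀ y, ‖fderiv ℝ z y‖ₑ ^ 2 ≤ n * ∑ i, ‖fderiv ℝ z y (e i)‖ₑ ^ 2 := by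
      intro y
      have h := opNorm_sq_le_sum' (fderiv ℝ z y)
      rw [← ofReal_norm, ← ENNReal.ofReal_pow (norm_nonneg _)]
      have hr : n * ∑ i, ‖fderiv ℝ z y (e i)‖ₑ ^ 2 = ENNReal.ofReal ((Module.finrank ℝ E' : ℝ) * ∑ i, ‖fderiv ℝ z y (e i)‖ ^ 2) := by
        rw [ENNReal.ofReal_mul (Nat.cast_nonneg _), ENNReal.ofReal_natCast, ENNReal.ofReal_sum_of_nonneg fun i _ ↦ sq_nonneg _]
        congr 1
        refine Finset.sum_congr rfl fun i _ ↦ ?_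
        rw [← ofReal_norm, ENNReal.ofReal_pow (norm_nonneg _)]
      rw [hr]
      exact ENNReal.ofReal_le_ofReal h
    calc (∫⁻ y, ‖fderiv ℝ z y‖ₑ ^ 2) ≤ ∫⁻ y, n * ∑ i, ‖fderiv ℝ z y (e i)‖ₑ ^ 2 := lintegral_mono hpt
      _ = n * ∑ i, ∫⁻ y, ‖fderiv ℝ z y (e i)‖ₑ ^ 2 := by
          rw [lintegral_const_mul' _ _ (ENNReal.natCast_ne_top _), lintegral_finsetSum' _ fun i _ ↦ ?_]
          exact ((continuous_enorm.comp (((hz.fderiv_right (m := ∞) (by norm_cast)).clm_apply contDiff_const).continuous)).measurable.pow_const 2).aemeasurable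
      _ ≤ n * sobolevEnergy 1 z := by
          refine mul_le_mul' le_rfl ?_
          rw [sobolevEnergy_succ]
          refine le_trans (Finset.sum_le_sum fun i _ ↦ ?_) le_add_self
          rw [sobolevEnergy_zero_left]
  induction k with
  | zero =>
    refine ⟨n, ENNReal.natCast_ne_top _, fun {z} hz ↦ ?_⟩
    rw [sobolevEnergy_zero_left]
    exact h0 hz
  | succ k ih =>
    obtain ⟨C, hCtop, hC⟩ := ih
    refine ⟨n + C, ENNReal.add_ne_top.2 ⟨ENNReal.natCast_ne_top _, hCtop⟩, fun {z} hz ↦ ?_⟩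
    set e := stdOrthonormalBasis ℝ E' with he
    rw [sobolevEnergy_succ]
    -- symmetry: `∂_b (Dz) = D(∂_b z)` as operator fields
    have hsymm : ∀ i, (fun y ↦ fderiv ℝ (fderiv ℝ z) y (e i)) = fderiv ℝ (fun y ↦ fderiv ℝ z y (e i)) := by
      intro i; funext y
      have h2 : (2 : ℕ∞ω) ≤ ((⊤ : ℕ∞) : ℕ∞ω) := WithTop.coe_le_coe.2 le_top
      have hS : IsSymmSndFDerivAt ℝ z y := (hz.contDiffAt (x := y)).isSymmSndFDerivAt (by simpa using h2)
      have hD : DifferentiableAt ℝ (fderiv ℝ z) y := ((hz.fderiv_right (m := ∞) (by norm_cast)).differentiable (by simp)) y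
      ext v
      rw [hS.eq (e i) v, fderiv_clm_apply hD (differentiableAt_const _)]
      simp
    have hzi : ∀ i, ContDiff ℝ ∞ fun y ↦ fderiv ℝ z y (e i) := fun i ↦ (hz.fderiv_right (m := ∞) (by norm_cast)).clm_apply contDiff_const
    calc (∫⁻ y, ‖fderiv ℝ z y‖ₑ ^ 2) + ∑ i, sobolevEnergy k (fun y ↦ fderiv ℝ (fderiv ℝ z) y (e i))
        ≤ n * sobolevEnergy 1 z + ∑ i, C * sobolevEnergy (k + 1) (fun y ↦ fderiv ℝ z y (e i)) := by
          refine add_le_add (h0 hz) (Finset.sum_le_sum fun i _ ↦ ?_)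
          rw [hsymm i]
          exact hC (hzi i)
      _ ≤ n * sobolevEnergy (k + 1 + 1) z + C * sobolevEnergy (k + 1 + 1) z := by
          rw [← Finset.mul_sum]
          refine add_le_add (mul_le_mul' le_rfl (sobolevEnergy_mono (by omega) z)) (mul_le_mul' le_rfl ?_)
          exact sum_sobolevEnergy_fderiv_frame_le (k + 1) z
      _ = (n + C) * sobolevEnergy (k + 1 + 1) z := by ring

/-- **Energies from pointwise domination of iterated derivatives** (two codomains): if for all
`i ≤ K` and all `y`, `‖Dⁱ Φ(y)‖ ≤ C Σ_{m ≤ i} ‖Dᵐ g(y)‖` (smooth `Φ, g`, possibly with different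
values), then `E_K(Φ) ≤ C' · C² · Σ_{m ≤ K} E_m(g)`. [cite: Adams1975, §1] -/
theorem sobolevEnergy_le_of_pointwise₂ {E : Type*} [NormedAddCommGroup E] [InnerProductSpace ℝ E] [FiniteDimensional ℝ E]
    [MeasurableSpace E] [BorelSpace E] {F₁ F₂ : Type*} [NormedAddCommGroup F₁] [NormedSpace ℝ F₁] [NormedAddCommGroup F₂] [NormedSpace ℝ F₂] (K : ℕ) :
    ∃ C' : ℝ≥0∞, C' ≠ ⊤ ∧ ∀ {Φ : E → F₁} {g : E → F₂}, ContDiff ℝ ∞ Φ → ContDiff ℝ ∞ g → ∀ {C : ℝ}, 0 ≤ C →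
      (∀ i ≤ K, ∀ y, ‖iteratedFDeriv ℝ i Φ y‖ ≤ C * ∑ m ∈ Finset.range (i + 1), ‖iteratedFDeriv ℝ m g y‖) →
      sobolevEnergy K Φ ≤ C' * ENNReal.ofReal (C ^ 2) * ∑ m ∈ Finset.range (K + 1), sobolevEnergy m g := by
  classical
  set n := Module.finrank ℝ E with hn
  set A : ℝ≥0∞ := ∑ m ∈ Finset.range (K + 1), ((n : ℝ≥0∞) ^ m) * ((K + 1 : ℕ) : ℝ≥0∞) * ENNReal.ofReal (((n : ℝ) ^ K) ^ 2 + 1) with hA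
  refine ⟨A, ?_, ?_⟩
  · exact ENNReal.sum_ne_top.2 fun m _ ↦ ENNReal.mul_ne_top (ENNReal.mul_ne_top (ENNReal.pow_ne_top (ENNReal.natCast_ne_top _)) (ENNReal.natCast_ne_top _))
      ENNReal.ofReal_ne_top
  intro Φ g hF hg C hC0 hdom
  set T := ∑ m ∈ Finset.range (K + 1), sobolevEnergy m g with hT
  -- `∫ ‖Dⁱ Φ‖² ≤ C² (i+1) Σ_{m≤i} ∫ ‖Dᵐ g‖² ≤ C² (K+1) (n^{2K}+1) T`
  have hint : ∀ i ≤ K, (∫⁻ y, ‖iteratedFDeriv ℝ i Φ y‖ₑ ^ 2) ≤ ENNReal.ofReal (C ^ 2) * (((K + 1 : ℕ) : ℝ≥0∞) * ENNReal.ofReal (((n : ℝ) ^ K) ^ 2 + 1) * T) := by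
    intro i hi
    have hpt : ∀ y, ‖iteratedFDeriv ℝ i Φ y‖ₑ ^ 2 ≤ ENNReal.ofReal (C ^ 2) * (((i + 1 : ℕ) : ℝ≥0∞) *
        ∑ m ∈ Finset.range (i + 1), ‖iteratedFDeriv ℝ m g y‖ₑ ^ 2) := by
      intro y
      have h := hdom i hi y
      -- Cauchy–Schwarz: `(Σ_{m≤i} a_m)² ≤ (i+1) Σ a_m²`
      have hcs : (∑ m ∈ Finset.range (i + 1), ‖iteratedFDeriv ℝ m g y‖) ^ 2 ≤ ((i + 1 : ℕ) : ℝ) * ∑ m ∈ Finset.range (i + 1), ‖iteratedFDeriv ℝ m g y‖ ^ 2 := by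
        have h1 := sq_sum_le_card_mul_sum_sq (s := Finset.range (i + 1)) (f := fun m ↦ ‖iteratedFDeriv ℝ m g y‖)
        simpa [Finset.card_range] using h1
      have hsq : ‖iteratedFDeriv ℝ i Φ y‖ ^ 2 ≤ C ^ 2 * (((i + 1 : ℕ) : ℝ) * ∑ m ∈ Finset.range (i + 1), ‖iteratedFDeriv ℝ m g y‖ ^ 2) := by
        calc ‖iteratedFDeriv ℝ i Φ y‖ ^ 2 ≤ (C * ∑ m ∈ Finset.range (i + 1), ‖iteratedFDeriv ℝ m g y‖) ^ 2 := pow_le_pow_left₀ (norm_nonneg _) h 2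
          _ = C ^ 2 * (∑ m ∈ Finset.range (i + 1), ‖iteratedFDeriv ℝ m g y‖) ^ 2 := by ring
          _ ≤ _ := mul_le_mul_of_nonneg_left hcs (sq_nonneg _)
      have hl : ‖iteratedFDeriv ℝ i Φ y‖ₑ ^ 2 = ENNReal.ofReal (‖iteratedFDeriv ℝ i Φ y‖ ^ 2) := by rw [← ofReal_norm, ENNReal.ofReal_pow (norm_nonneg _)]
      have hr : ∑ m ∈ Finset.range (i + 1), ‖iteratedFDeriv ℝ m g y‖ₑ ^ 2 = ENNReal.ofReal (∑ m ∈ Finset.range (i + 1), ‖iteratedFDeriv ℝ m g y‖ ^ 2) := by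
        rw [ENNReal.ofReal_sum_of_nonneg fun m _ ↦ sq_nonneg _]
        refine Finset.sum_congr rfl fun m _ ↦ ?_
        rw [← ofReal_norm, ENNReal.ofReal_pow (norm_nonneg _)]
      rw [hl, hr, ← ENNReal.ofReal_natCast, ← ENNReal.ofReal_mul (Nat.cast_nonneg _), ← ENNReal.ofReal_mul (sq_nonneg _)]
      exact ENNReal.ofReal_le_ofReal hsq
    calc (∫⁻ y, ‖iteratedFDeriv ℝ i Φ y‖ₑ ^ 2)
        ≤ ∫⁻ y, ENNReal.ofReal (C ^ 2) * (((i + 1 : ℕ) : ℝ≥0∞) * ∑ m ∈ Finset.range (i + 1), ‖iteratedFDeriv ℝ m g y‖ₑ ^ 2) := lintegral_mono hpt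
      _ = ENNReal.ofReal (C ^ 2) * (((i + 1 : ℕ) : ℝ≥0∞) * ∑ m ∈ Finset.range (i + 1), ∫⁻ y, ‖iteratedFDeriv ℝ m g y‖ₑ ^ 2) := by
          rw [lintegral_const_mul' _ _ ENNReal.ofReal_ne_top, lintegral_const_mul' _ _ (ENNReal.natCast_ne_top _), lintegral_finsetSum' _ fun m _ ↦ ?_]
          exact ((continuous_enorm.comp (hg.continuous_iteratedFDeriv (m := m) (by exact_mod_cast le_top))).measurable.pow_const 2).aemeasurable
      _ ≤ ENNReal.ofReal (C ^ 2) * (((K + 1 : ℕ) : ℝ≥0∞) * ENNReal.ofReal (((n : ℝ) ^ K) ^ 2 + 1) * T) := by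
          refine mul_le_mul' le_rfl ?_
          rw [mul_assoc]
          refine mul_le_mul' (by exact_mod_cast (show i + 1 ≤ K + 1 by omega)) ?_
          rw [hT, Finset.mul_sum]
          refine (Finset.sum_le_sum_of_subset_of_nonneg (Finset.range_mono (by omega)) fun _ _ _ ↦ bot_le).trans (Finset.sum_le_sum fun m hm ↦ ?_)
          have hm' : m ≤ K := Nat.lt_succ_iff.1 (Finset.mem_range.1 hm)
          refine (lintegral_iteratedFDeriv_sq_le hg m).trans (mul_le_mul' (ENNReal.ofReal_le_ofReal ?_) le_rfl)
          rcases Nat.eq_zero_or_pos n with h0 | hpos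
          · have h1 : ((n : ℝ) ^ m) ^ 2 ≤ 1 := by
              rw [h0, Nat.cast_zero]
              exact pow_le_one₀ (by positivity) (pow_le_one₀ le_rfl zero_le_one)
            have h2 : 0 ≤ ((n : ℝ) ^ K) ^ 2 := sq_nonneg _
            linarith
          · have h1 : ((n : ℝ) ^ m) ^ 2 ≤ ((n : ℝ) ^ K) ^ 2 :=
              pow_le_pow_left₀ (by positivity) (pow_le_pow_right₀ (by exact_mod_cast hpos) hm') 2
            linarith
  -- assemble with `E_K(Φ) ≤ Σ_i n^i ∫ ‖Dⁱ Φ‖²`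
  refine (sobolevEnergy_le_sum_lintegral_iteratedFDeriv hF K).trans ?_
  calc ∑ i ∈ Finset.range (K + 1), ((n : ℝ≥0∞) ^ i) * ∫⁻ y, ‖iteratedFDeriv ℝ i Φ y‖ₑ ^ 2
      ≤ ∑ i ∈ Finset.range (K + 1), ((n : ℝ≥0∞) ^ i) * (ENNReal.ofReal (C ^ 2) * (((K + 1 : ℕ) : ℝ≥0∞) * ENNReal.ofReal (((n : ℝ) ^ K) ^ 2 + 1) * T)) :=
        Finset.sum_le_sum fun i hi ↦ mul_le_mul' le_rfl (hint i (Nat.lt_succ_iff.1 (Finset.mem_range.1 hi)))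
    _ = A * ENNReal.ofReal (C ^ 2) * T := by rw [hA, Finset.sum_mul, Finset.sum_mul]; exact Finset.sum_congr rfl fun i _ ↦ by ring

/-- **Energies of frame components of the Hessian**: for every `k` there is `C < ∞` with
`E_k(y ↦ D²z(y) v w) ≤ C ‖v‖² ‖w‖² E_{k+2}(z)` for smooth `z`. [folklore] -/
theorem sobolevEnergy_hessComp_le (k : ℕ) :
    ∃ C : ℝ≥0∞, C ≠ ⊤ ∧ ∀ {z : E' → W}, ContDiff ℝ ∞ z → ∀ v w : E',
      sobolevEnergy k (fun y ↦ fderiv ℝ (fderiv ℝ z) y v w) ≤ C * ENNReal.ofReal ((‖v‖ * ‖w‖) ^ 2) * sobolevEnergy (k + 2) z := by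
  obtain ⟨C₁, hC₁top, hC₁⟩ := sobolevEnergy_fderiv_le (E' := E') (V := E' →L[ℝ] W) k
  obtain ⟨C₂, hC₂top, hC₂⟩ := sobolevEnergy_fderiv_le (E' := E') (V := W) (k + 1)
  obtain ⟨Cp, hCptop, hCp⟩ := sobolevEnergy_le_of_pointwise₂ (E := E') (F₁ := W) (F₂ := E' →L[ℝ] E' →L[ℝ] W) k
  refine ⟨Cp * (((k + 1 : ℕ) : ℝ≥0∞) * C₁ * C₂), ENNReal.mul_ne_top hCptop
    (ENNReal.mul_ne_top (ENNReal.mul_ne_top (ENNReal.natCast_ne_top _) hC₁top) hC₂top), fun {z} hz v w ↦ ?_⟩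
  have hvw : 0 ≤ ‖v‖ * ‖w‖ := mul_nonneg (norm_nonneg _) (norm_nonneg _)
  have hDD : ContDiff ℝ ∞ (fderiv ℝ (fderiv ℝ z)) := (hz.fderiv_right (m := ∞) (by norm_cast)).fderiv_right (m := ∞) (by norm_cast)
  have hψ : ContDiff ℝ ∞ fun y ↦ fderiv ℝ (fderiv ℝ z) y v w := (hDD.clm_apply contDiff_const).clm_apply contDiff_const
  -- pointwise domination `‖Dⁱ ψ‖ ≤ ‖v‖ ‖w‖ ‖Dⁱ (D²z)‖`
  have hdom : ∀ i ≤ k, ∀ y, ‖iteratedFDeriv ℝ i (fun y ↦ fderiv ℝ (fderiv ℝ z) y v w) y‖ ≤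
      (‖v‖ * ‖w‖) * ∑ m ∈ Finset.range (i + 1), ‖iteratedFDeriv ℝ m (fderiv ℝ (fderiv ℝ z)) y‖ := by
    intro i _ y
    have h1 := norm_iteratedFDeriv_clm_apply_const (f := fun y ↦ fderiv ℝ (fderiv ℝ z) y v) (c := w) (x := y) (N := ∞) (n := i)
      ((hDD.clm_apply contDiff_const).contDiffAt) (by exact_mod_cast le_top)
    have h2 := norm_iteratedFDeriv_clm_apply_const (f := fderiv ℝ (fderiv ℝ z)) (c := v) (x := y) (N := ∞) (n := i)
      hDD.contDiffAt (by exact_mod_cast le_top)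
    calc _ ≤ ‖w‖ * ‖iteratedFDeriv ℝ i (fun y ↦ fderiv ℝ (fderiv ℝ z) y v) y‖ := h1
      _ ≤ ‖w‖ * (‖v‖ * ‖iteratedFDeriv ℝ i (fderiv ℝ (fderiv ℝ z)) y‖) := mul_le_mul_of_nonneg_left h2 (norm_nonneg _)
      _ = (‖v‖ * ‖w‖) * ‖iteratedFDeriv ℝ i (fderiv ℝ (fderiv ℝ z)) y‖ := by ring
      _ ≤ _ := by
          refine mul_le_mul_of_nonneg_left ?_ hvw
          exact Finset.single_le_sum (f := fun m ↦ ‖iteratedFDeriv ℝ m (fderiv ℝ (fderiv ℝ z)) y‖) (fun _ _ ↦ norm_nonneg _)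
            (Finset.mem_range.2 (Nat.lt_succ_self i))
  refine (hCp hψ hDD hvw hdom).trans ?_
  -- `Σ_{m ≤ k} E_m(D²z) ≤ (k+1) E_k(D²z) ≤ (k+1) C₁ C₂ E_{k+2}(z)`
  have hsum : ∑ m ∈ Finset.range (k + 1), sobolevEnergy m (fderiv ℝ (fderiv ℝ z)) ≤ ((k + 1 : ℕ) : ℝ≥0∞) * C₁ * C₂ * sobolevEnergy (k + 2) z := by
    calc _ ≤ ∑ _m ∈ Finset.range (k + 1), sobolevEnergy k (fderiv ℝ (fderiv ℝ z)) :=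
          Finset.sum_le_sum fun m hm ↦ sobolevEnergy_mono (Nat.lt_succ_iff.1 (Finset.mem_range.1 hm)) _
      _ = ((k + 1 : ℕ) : ℝ≥0∞) * sobolevEnergy k (fderiv ℝ (fderiv ℝ z)) := by rw [Finset.sum_const, Finset.card_range, nsmul_eq_mul]
      _ ≤ ((k + 1 : ℕ) : ℝ≥0∞) * (C₁ * (C₂ * sobolevEnergy (k + 1 + 1) z)) :=
          mul_le_mul' le_rfl ((hC₁ (hz.fderiv_right (m := ∞) (by norm_cast))).trans (mul_le_mul' le_rfl (hC₂ hz)))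
      _ = _ := by ring_nf
  calc Cp * ENNReal.ofReal ((‖v‖ * ‖w‖) ^ 2) * ∑ m ∈ Finset.range (k + 1), sobolevEnergy m (fderiv ℝ (fderiv ℝ z))
      ≤ Cp * ENNReal.ofReal ((‖v‖ * ‖w‖) ^ 2) * (((k + 1 : ℕ) : ℝ≥0∞) * C₁ * C₂ * sobolevEnergy (k + 2) z) := mul_le_mul' le_rfl hsum
    _ = Cp * (((k + 1 : ℕ) : ℝ≥0∞) * C₁ * C₂) * ENNReal.ofReal ((‖v‖ * ‖w‖) ^ 2) * sobolevEnergy (k + 2) z := by ring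


/-! ### The flat Picard source and its energy -/

section Theta

variable [FiniteDimensional ℝ W] {ι : Type*} [Fintype ι]

/-- **The flat Picard source**:
`Θ♭(z)(y) = cut y • (Σᵢᵢ' Gᶜᵢᵢ'(y, 𝔷 y) • D²z(y) (Avᵢ) (Avᵢ') + Gʳ(y, 𝔷 y)) + g₀ y`.
[cite: TaylorPDEIII2011, Ch. 15, §7] -/
def thetaFlat (Av : ι → E') (cut : E' → ℝ) (Gc : ι → ι → (E' × (W × (E' →L[ℝ] W)) → ℝ))
    (Gr : E' × (W × (E' →L[ℝ] W)) → W) (g₀ : E' → W) (z : E' → W) (y : E') : W :=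
  cut y • ((∑ i, ∑ i', Gc i i' (y, jetOf z y) • fderiv ℝ (fderiv ℝ z) y (Av i) (Av i')) + Gr (y, jetOf z y)) + g₀ y

omit [FiniteDimensional ℝ E'] [MeasurableSpace E'] [BorelSpace E'] [FiniteDimensional ℝ W] in
/-- Iterated derivatives of the jet: `‖Dᵐ 𝔷(y)‖ ≤ ‖Dᵐ z(y)‖ + ‖D^{m+1} z(y)‖`. [folklore] -/
theorem norm_iteratedFDeriv_jetOf_le {z : E' → W} (hz : ContDiff ℝ ∞ z) (m : ℕ) (y : E') :
    ‖iteratedFDeriv ℝ m (jetOf z) y‖ ≤ ‖iteratedFDeriv ℝ m z y‖ + ‖iteratedFDeriv ℝ (m + 1) z y‖ := by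
  have hD : ContDiff ℝ ∞ (fderiv ℝ z) := hz.fderiv_right (m := ∞) (by norm_cast)
  have heq : jetOf z = fun y ↦ (ContinuousLinearMap.inl ℝ W (E' →L[ℝ] W)) (z y) + (ContinuousLinearMap.inr ℝ W (E' →L[ℝ] W)) (fderiv ℝ z y) := by
    funext y; simp [jetOf]
  rw [heq, fun_iteratedFDeriv_add_apply ((contDiff_const.clm_apply hz).contDiffAt.of_le (by exact_mod_cast le_top))
    ((contDiff_const.clm_apply hD).contDiffAt.of_le (by exact_mod_cast le_top))]
  refine (norm_add_le _ _).trans (add_le_add ?_ ?_)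
  · have h := (ContinuousLinearMap.inl ℝ W (E' →L[ℝ] W)).norm_iteratedFDeriv_comp_left (f := z) (x := y) (N := ∞) (n := m)
      hz.contDiffAt (by exact_mod_cast le_top)
    refine h.trans ?_
    calc _ ≤ 1 * ‖iteratedFDeriv ℝ m z y‖ := mul_le_mul_of_nonneg_right (ContinuousLinearMap.norm_inl_le_one ℝ W _) (norm_nonneg _)
      _ = _ := one_mul _
  · have h := (ContinuousLinearMap.inr ℝ W (E' →L[ℝ] W)).norm_iteratedFDeriv_comp_left (f := fderiv ℝ z) (x := y) (N := ∞) (n := m)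
      hD.contDiffAt (by exact_mod_cast le_top)
    refine h.trans ?_
    calc _ ≤ 1 * ‖iteratedFDeriv ℝ m (fderiv ℝ z) y‖ := mul_le_mul_of_nonneg_right (ContinuousLinearMap.norm_inr_le_one ℝ W _) (norm_nonneg _)
      _ = _ := by rw [one_mul, norm_iteratedFDeriv_fderiv]

omit [FiniteDimensional ℝ E'] [MeasurableSpace E'] [BorelSpace E'] [FiniteDimensional ℝ W] in
/-- A smooth compactly supported function has bounded iterated derivatives up to any order.
[folklore] -/
theorem exists_forall_norm_iteratedFDeriv_le {V : Type*} [NormedAddCommGroup V] [NormedSpace ℝ V] {f : E' → V} (hf : ContDiff ℝ ∞ f)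
    (hfc : HasCompactSupport f) (K : ℕ) : ∃ M : ℝ, 0 ≤ M ∧ ∀ m ≤ K, ∀ y, ‖iteratedFDeriv ℝ m f y‖ ≤ M := by
  have h : ∀ m : ℕ, ∃ C, 0 ≤ C ∧ ∀ y, ‖iteratedFDeriv ℝ m f y‖ ≤ C := fun m ↦
    exists_bound_of_hasCompactSupport (hf.continuous_iteratedFDeriv (m := m) (by exact_mod_cast le_top)) (hfc.iteratedFDeriv m)
  choose C hC0 hC using h
  refine ⟨∑ m ∈ Finset.range (K + 1), C m, Finset.sum_nonneg fun m _ ↦ hC0 m, fun m hm y ↦ (hC m y).trans ?_⟩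
  exact Finset.single_le_sum (f := C) (fun m _ ↦ hC0 m) (Finset.mem_range.2 (by omega))

/-- **Smooth compactly supported functions have finite energies.** [folklore] -/
theorem sobolevEnergy_ne_top_of_hasCompactSupport {V : Type*} [NormedAddCommGroup V] [NormedSpace ℝ V] {f : E' → V} (hf : ContDiff ℝ ∞ f)
    (hfc : HasCompactSupport f) (K : ℕ) : sobolevEnergy K f ≠ ⊤ := by
  obtain ⟨M, hM0, hM⟩ := exists_forall_norm_iteratedFDeriv_le hf hfc K
  have hvol : volume (tsupport f) ≠ ⊤ := hfc.isCompact.measure_lt_top.ne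
  refine ne_top_of_le_ne_top ?_ (sobolevEnergy_le_sum_lintegral_iteratedFDeriv hf K)
  refine ENNReal.sum_ne_top.2 fun m hm ↦ ENNReal.mul_ne_top (ENNReal.pow_ne_top (ENNReal.natCast_ne_top _)) ?_
  have hle : (∫⁻ y, ‖iteratedFDeriv ℝ m f y‖ₑ ^ 2) ≤ ENNReal.ofReal (M ^ 2) * volume (tsupport f) :=
    lintegral_enorm_sq_le_of_bound_of_support (K := tsupport f) (C := M) (hM m (Nat.lt_succ_iff.1 (Finset.mem_range.1 hm)))
      fun y hy ↦ image_eq_zero_of_notMem_tsupport fun h ↦ hy (tsupport_iteratedFDeriv_subset m h)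
  exact ne_top_of_le_ne_top (ENNReal.mul_ne_top ENNReal.ofReal_ne_top hvol) hle

/-- **The flat energy estimate (boundedness form).** For the data of the flat Picard source and
every order `K` there is `C_top < ∞`, and for every `R` there is `B < ∞`, such that for every
smooth compactly supported `z` with `‖Dᵐ z‖ ≤ R` (`m ≤ K/2 + 3`) and every `δ ≥ 0` bounding
`|Gᶜᵢᵢ'(y, 𝔷 y)|`:
`E_K(Θ♭(z)) ≤ C_top δ² E_{K+2}(z) + B (1 + E_{K+1}(z))`.
[cite: TaylorPDEIII2011, Ch. 15, §7] -/
theorem energy_thetaFlat_le (Av : ι → E') (K : ℕ) {cut : E' → ℝ} (hcut : ContDiff ℝ ∞ cut) (hcutc : HasCompactSupport cut)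
    {Gc : ι → ι → (E' × (W × (E' →L[ℝ] W)) → ℝ)} (hGc : ∀ i i', ContDiff ℝ ∞ (Gc i i')) (hGcc : ∀ i i', HasCompactSupport (Gc i i'))
    {Gr : E' × (W × (E' →L[ℝ] W)) → W} (hGr : ContDiff ℝ ∞ Gr) (hGrc : HasCompactSupport Gr) {g₀ : E' → W} (hg₀ : ContDiff ℝ ∞ g₀) (hg₀c : HasCompactSupport g₀) :
    ∃ Ctop : ℝ≥0∞, Ctop ≠ ⊤ ∧ ∀ R : ℝ, ∃ B : ℝ≥0∞, B ≠ ⊤ ∧ ∀ {z : E' → W}, ContDiff ℝ ∞ z → HasCompactSupport z →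
      (∀ m ≤ K / 2 + 3, ∀ y, ‖iteratedFDeriv ℝ m z y‖ ≤ R) → ∀ {δ : ℝ}, 0 ≤ δ → (∀ i i' y, |Gc i i' (y, jetOf z y)| ≤ δ) →
      sobolevEnergy K (thetaFlat Av cut Gc Gr g₀ z) ≤
        Ctop * ENNReal.ofReal (δ ^ 2) * sobolevEnergy (K + 2) z + B * (1 + sobolevEnergy (K + 1) z) := by
  classical
  /- ## fixed constants (independent of `R`) -/
  obtain ⟨Mcut, hMcut0, hMcut⟩ := exists_forall_norm_iteratedFDeriv_le hcut hcutc K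
  obtain ⟨Ccut, hCcuttop, hCcut⟩ := sobolevEnergy_smul_le_crude (E := E') (F := W) K
  obtain ⟨CA, hCAtop, hCA⟩ := sobolevEnergy_hessComp_le (E' := E') (W := W) K
  obtain ⟨CA', hCA'top, hCA'⟩ := sobolevEnergy_hessComp_le (E' := E') (W := W) (K - 1)
  obtain ⟨Chl, hChltop, hChl⟩ := sobolevEnergy_bilinear_highlow_sharp (E := E') (G₁ := ℝ) (G₂ := W) (F := W) K (ε := 1) one_pos le_rfl
  obtain ⟨Cf, hCftop, hCf⟩ := sobolevEnergy_fderiv_le (E' := E') (V := W) K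
  set Amax : ℝ := ∑ i, ‖Av i‖ with hAmax
  have hAmax0 : 0 ≤ Amax := Finset.sum_nonneg fun i _ ↦ norm_nonneg _
  have hAi : ∀ i, ‖Av i‖ ≤ Amax := fun i ↦ Finset.single_le_sum (f := fun i ↦ ‖Av i‖) (fun _ _ ↦ norm_nonneg _) (Finset.mem_univ i)
  set cι : ℝ≥0∞ := (Fintype.card ι : ℝ≥0∞) with hcι
  -- the top constant
  set Ctop : ℝ≥0∞ := 2 * (Ccut * ENNReal.ofReal (Mcut ^ 2)) * (2 * (cι * cι * (cι * cι))) * (2 * CA * ENNReal.ofReal ((Amax * Amax) ^ 2)) with hCtop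
  refine ⟨Ctop, ?_, fun R ↦ ?_⟩
  · simp only [hCtop]
    exact ENNReal.mul_ne_top (ENNReal.mul_ne_top (ENNReal.mul_ne_top (by simp) (ENNReal.mul_ne_top hCcuttop ENNReal.ofReal_ne_top))
      (ENNReal.mul_ne_top (by simp) (ENNReal.mul_ne_top (ENNReal.mul_ne_top (ENNReal.natCast_ne_top _) (ENNReal.natCast_ne_top _))
        (ENNReal.mul_ne_top (ENNReal.natCast_ne_top _) (ENNReal.natCast_ne_top _)))))
      (ENNReal.mul_ne_top (ENNReal.mul_ne_top (by simp) hCAtop) ENNReal.ofReal_ne_top)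
  /- ## constants depending on `R` -/
  set h : ℕ := K / 2 + 1 with hh
  -- sup bounds of the coefficient composites up to order `K/2` (jets bounded by `2R`)
  have ha := fun i i' ↦ norm_iteratedFDeriv_jetComp_le (K / 2) (hGc i i') (hGcc i i') (|R| + |R|)
  choose Ca hCa0 hCa using ha
  set Camax : ℝ := ∑ i, ∑ i', Ca i i' with hCamax
  have hCamax0 : 0 ≤ Camax := Finset.sum_nonneg fun i _ ↦ Finset.sum_nonneg fun i' _ ↦ hCa0 i i'
  have hCai : ∀ i i', Ca i i' ≤ Camax := fun i i' ↦ (Finset.single_le_sum (f := fun i' ↦ Ca i i') (fun _ _ ↦ hCa0 i _) (Finset.mem_univ i')).trans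
    (Finset.single_le_sum (f := fun i ↦ ∑ i', Ca i i') (fun _ _ ↦ Finset.sum_nonneg fun _ _ ↦ hCa0 _ _) (Finset.mem_univ i))
  -- energies of the composites up to order `K` (jets bounded by `2R` up to order `K/2 + 1`)
  have hc := fun i i' ↦ sobolevEnergy_jetComp_le K (hGc i i') (hGcc i i') (|R| + |R|)
  choose Cc hCctop hCc using hc
  obtain ⟨Cr, hCrtop, hCr⟩ := sobolevEnergy_jetComp_le K hGr hGrc (|R| + |R|)
  set Ccmax : ℝ≥0∞ := ∑ i, ∑ i', Cc i i' with hCcmax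
  have hCcmaxtop : Ccmax ≠ ⊤ := ENNReal.sum_ne_top.2 fun i _ ↦ ENNReal.sum_ne_top.2 fun i' _ ↦ hCctop i i'
  have hCci : ∀ i i', Cc i i' ≤ Ccmax := fun i i' ↦ (Finset.single_le_sum (f := fun i' ↦ Cc i i') (fun _ _ ↦ bot_le) (Finset.mem_univ i')).trans
    (Finset.single_le_sum (f := fun i ↦ ∑ i', Cc i i') (fun _ _ ↦ bot_le) (Finset.mem_univ i))
  -- the sup bound `N` of the low derivatives of the Hessian components
  set Nψ : ℝ := Amax * Amax * |R| with hNψ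
  have hNψ0 : 0 ≤ Nψ := by positivity
  -- the `R`-constant
  set Slow : ℝ≥0∞ := ((K + 1 : ℕ) : ℝ≥0∞) * (1 + Cf) with hSlow
  have hSlowtop : Slow ≠ ⊤ := ENNReal.mul_ne_top (ENNReal.natCast_ne_top _) (ENNReal.add_ne_top.2 ⟨ENNReal.one_ne_top, hCftop⟩)
  set Bpair : ℝ≥0∞ := Chl * ((h : ℝ≥0∞) * ENNReal.ofReal (Camax ^ 2) * (CA' * ENNReal.ofReal ((Amax * Amax) ^ 2)) +
    ENNReal.ofReal (Nψ ^ 2) * ((K + 1 : ℕ) : ℝ≥0∞) * Ccmax * (1 + Slow)) with hBpair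
  have hBpairtop : Bpair ≠ ⊤ := ENNReal.mul_ne_top hChltop (ENNReal.add_ne_top.2
    ⟨ENNReal.mul_ne_top (ENNReal.mul_ne_top (ENNReal.natCast_ne_top _) ENNReal.ofReal_ne_top) (ENNReal.mul_ne_top hCA'top ENNReal.ofReal_ne_top),
     ENNReal.mul_ne_top (ENNReal.mul_ne_top (ENNReal.mul_ne_top ENNReal.ofReal_ne_top (ENNReal.natCast_ne_top _)) hCcmaxtop)
      (ENNReal.add_ne_top.2 ⟨ENNReal.one_ne_top, hSlowtop⟩)⟩)
  have hg₀E : sobolevEnergy K g₀ ≠ ⊤ := sobolevEnergy_ne_top_of_hasCompactSupport hg₀ hg₀c K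
  set B : ℝ≥0∞ := 2 * (Ccut * ENNReal.ofReal (Mcut ^ 2)) * (2 * (cι * cι * (cι * cι)) * Bpair + 2 * (Cr * (1 + Slow))) + 2 * sobolevEnergy K g₀ with hB
  refine ⟨B, ?_, fun {z} hz hzc hR δ hδ0 hδ ↦ ?_⟩
  · exact ENNReal.add_ne_top.2 ⟨ENNReal.mul_ne_top (ENNReal.mul_ne_top (by simp) (ENNReal.mul_ne_top hCcuttop ENNReal.ofReal_ne_top))
      (ENNReal.add_ne_top.2 ⟨ENNReal.mul_ne_top (ENNReal.mul_ne_top (by simp) (ENNReal.mul_ne_top (ENNReal.mul_ne_top (ENNReal.natCast_ne_top _) (ENNReal.natCast_ne_top _))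
        (ENNReal.mul_ne_top (ENNReal.natCast_ne_top _) (ENNReal.natCast_ne_top _)))) hBpairtop,
        ENNReal.mul_ne_top (by simp) (ENNReal.mul_ne_top hCrtop (ENNReal.add_ne_top.2 ⟨ENNReal.one_ne_top, hSlowtop⟩))⟩),
      ENNReal.mul_ne_top (by simp) hg₀E⟩
  /- ## the pieces -/
  set 𝔷 : E' → W × (E' →L[ℝ] W) := jetOf z with h𝔷
  have h𝔷s : ContDiff ℝ ∞ 𝔷 := contDiff_jetOf hz
  have hD : ContDiff ℝ ∞ (fderiv ℝ z) := hz.fderiv_right (m := ∞) (by norm_cast)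
  have hDD : ContDiff ℝ ∞ (fderiv ℝ (fderiv ℝ z)) := hD.fderiv_right (m := ∞) (by norm_cast)
  -- jet bounds: `‖Dᵐ 𝔷‖ ≤ 2R` for `m ≤ K/2 + 2`
  have h𝔷b : ∀ m ≤ K / 2 + 2, ∀ y, ‖iteratedFDeriv ℝ m 𝔷 y‖ ≤ |R| + |R| := by
    intro m hm y
    refine (norm_iteratedFDeriv_jetOf_le hz m y).trans (add_le_add ?_ ?_)
    · exact (hR m (by omega) y).trans (le_abs_self R)
    · exact (hR (m + 1) (by omega) y).trans (le_abs_self R)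
  set X1 := sobolevEnergy (K + 1) z with hX1
  set X2 := sobolevEnergy (K + 2) z with hX2
  have hzK : sobolevEnergy K z ≤ X1 := sobolevEnergy_mono (Nat.le_succ K) z
  have hDz : sobolevEnergy K (fderiv ℝ z) ≤ Cf * X1 := hCf hz
  -- `Σ_{m ≤ i} E_m(𝔷) ≤ Slow X1` for `i ≤ K`
  have h𝔷E : ∀ i ≤ K, ∑ m ∈ Finset.range (i + 1), sobolevEnergy m 𝔷 ≤ Slow * X1 := by
    intro i hi
    calc _ ≤ ∑ _m ∈ Finset.range (i + 1), (sobolevEnergy K z + sobolevEnergy K (fderiv ℝ z)) := by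
          refine Finset.sum_le_sum fun m hm ↦ ?_
          have hm' : m ≤ K := (Nat.lt_succ_iff.1 (Finset.mem_range.1 hm)).trans hi
          exact (sobolevEnergy_jetOf_le m hz).trans (add_le_add (sobolevEnergy_mono hm' _) (sobolevEnergy_mono hm' _))
      _ ≤ ((K + 1 : ℕ) : ℝ≥0∞) * (sobolevEnergy K z + sobolevEnergy K (fderiv ℝ z)) := by
          rw [Finset.sum_const, Finset.card_range, nsmul_eq_mul]
          exact mul_le_mul' (by exact_mod_cast (show i + 1 ≤ K + 1 by omega)) le_rfl
      _ ≤ ((K + 1 : ℕ) : ℝ≥0∞) * (X1 + Cf * X1) := mul_le_mul' le_rfl (add_le_add hzK hDz)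
      _ = Slow * X1 := by rw [hSlow]; ring
  -- the Hessian components
  set ψ : ι → ι → E' → W := fun i i' y ↦ fderiv ℝ (fderiv ℝ z) y (Av i) (Av i') with hψ
  have hψs : ∀ i i', ContDiff ℝ ∞ (ψ i i') := fun i i' ↦ (hDD.clm_apply contDiff_const).clm_apply contDiff_const
  have hA4 : ∀ i i', ENNReal.ofReal ((‖Av i‖ * ‖Av i'‖) ^ 2) ≤ ENNReal.ofReal ((Amax * Amax) ^ 2) := fun i i' ↦
    ENNReal.ofReal_le_ofReal (pow_le_pow_left₀ (by positivity) (mul_le_mul (hAi i) (hAi i') (norm_nonneg _) hAmax0) 2)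
  have hψK : ∀ i i', sobolevEnergy K (ψ i i') ≤ CA * ENNReal.ofReal ((Amax * Amax) ^ 2) * X2 := fun i i' ↦
    (hCA hz (Av i) (Av i')).trans (mul_le_mul' (mul_le_mul' le_rfl (hA4 i i')) le_rfl)
  have hψlow : ∀ i i', ∀ j, 1 ≤ j → j < h → sobolevEnergy (K - j) (ψ i i') ≤ CA' * ENNReal.ofReal ((Amax * Amax) ^ 2) * X1 := by
    intro i i' j hj1 hjh
    have hK2 : 2 ≤ K := by simp only [hh] at hjh; omega
    have h1 : sobolevEnergy (K - j) (ψ i i') ≤ sobolevEnergy (K - 1) (ψ i i') := sobolevEnergy_mono (by omega) _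
    refine h1.trans ((hCA' hz (Av i) (Av i')).trans ?_)
    rw [show K - 1 + 2 = K + 1 by omega]
    exact mul_le_mul' (mul_le_mul' le_rfl (hA4 i i')) le_rfl
  -- sup bounds of the low derivatives of `ψ`: `‖Dᵐ ψ‖ ≤ ‖Av i‖ ‖Av i'‖ ‖D^{m+2} z‖ ≤ Nψ` for `m + h ≤ K`
  have hψN : ∀ i i', ∀ m, m + h ≤ K → ∀ y, ‖iteratedFDeriv ℝ m (ψ i i') y‖ ≤ Nψ := by
    intro i i' m hm y
    have h1 := norm_iteratedFDeriv_clm_apply_const (f := fun y ↦ fderiv ℝ (fderiv ℝ z) y (Av i)) (c := Av i') (x := y) (N := ∞) (n := m)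
      ((hDD.clm_apply contDiff_const).contDiffAt) (by exact_mod_cast le_top)
    have h2 := norm_iteratedFDeriv_clm_apply_const (f := fderiv ℝ (fderiv ℝ z)) (c := Av i) (x := y) (N := ∞) (n := m)
      hDD.contDiffAt (by exact_mod_cast le_top)
    have h3 : ‖iteratedFDeriv ℝ m (fderiv ℝ (fderiv ℝ z)) y‖ ≤ |R| := by
      rw [norm_iteratedFDeriv_fderiv, norm_iteratedFDeriv_fderiv]
      exact (hR (m + 1 + 1) (by simp only [hh] at hm; omega) y).trans (le_abs_self R)
    calc ‖iteratedFDeriv ℝ m (ψ i i') y‖ ≤ ‖Av i'‖ * ‖iteratedFDeriv ℝ m (fun y ↦ fderiv ℝ (fderiv ℝ z) y (Av i)) y‖ := h1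
      _ ≤ ‖Av i'‖ * (‖Av i‖ * ‖iteratedFDeriv ℝ m (fderiv ℝ (fderiv ℝ z)) y‖) := mul_le_mul_of_nonneg_left h2 (norm_nonneg _)
      _ ≤ Amax * (Amax * |R|) := mul_le_mul (hAi i') (mul_le_mul (hAi i) h3 (norm_nonneg _) hAmax0) (by positivity) hAmax0
      _ = Nψ := by rw [hNψ]; ring
  -- the coefficient composites
  set φ : ι → ι → E' → ℝ := fun i i' ↦ jetComp (Gc i i') 𝔷 with hφ
  have hφs : ∀ i i', ContDiff ℝ ∞ (φ i i') := fun i i' ↦ contDiff_jetComp (hGc i i') h𝔷s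
  set Mφ : ℕ → ℝ := fun j ↦ if j = 0 then δ else Camax with hMφ
  have hMφ0 : Mφ 0 = δ := by simp [hMφ]
  have hφM : ∀ i i', ∀ j < h, ∀ y, ‖iteratedFDeriv ℝ j (φ i i') y‖ ≤ Mφ j := by
    intro i i' j hj y
    rcases Nat.eq_zero_or_pos j with rfl | hjpos
    · rw [hMφ0, norm_iteratedFDeriv_zero]
      have h := hδ i i' y
      rw [Real.norm_eq_abs]; exact h
    · rw [show Mφ j = Camax by simp [hMφ, hjpos.ne']]
      refine (hCa i i' h𝔷s (fun m hm y ↦ h𝔷b m (by simp only [hh] at hj; omega) y) j (by simp only [hh] at hj; omega) y).trans (hCai i i')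
  have hφE : ∀ i i', ∀ j ≤ K, sobolevEnergy j (φ i i') ≤ Ccmax * (1 + Slow * X1) := by
    intro i i' j hj
    refine (hCc i i' h𝔷s (fun m hm y ↦ h𝔷b m (by omega) y) j hj).trans ?_
    exact mul_le_mul' (hCci i i') (add_le_add le_rfl (h𝔷E j hj))
  /- ## the product terms by the sharp high–low bound -/
  obtain ⟨Bs, hBs⟩ : ∃ Bs : ℝ →L[ℝ] W →L[ℝ] W, Bs = ContinuousLinearMap.lsmul ℝ ℝ := ⟨_, rfl⟩
  have hBsapp : ∀ (r : ℝ) (w : W), Bs r w = r • w := fun r w ↦ by rw [hBs]; rfl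
  have hBsn : ‖Bs‖ ≤ 1 := by rw [hBs]; exact ContinuousLinearMap.opNorm_lsmul_le
  have hh1 : 1 ≤ h := by simp [hh]
  have hhK : h ≤ K + 1 := by simp only [hh]; omega
  have hprod : ∀ i i', sobolevEnergy K (fun y ↦ φ i i' y • ψ i i' y) ≤
      (2 * CA * ENNReal.ofReal ((Amax * Amax) ^ 2)) * ENNReal.ofReal (δ ^ 2) * X2 + Bpair * (1 + X1) := by
    intro i i'
    have hfun : (fun y ↦ φ i i' y • ψ i i' y) = fun y ↦ Bs (φ i i' y) (ψ i i' y) := by funext y; rw [hBsapp]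
    rw [hfun]
    have hsharp := hChl Bs (hφs i i') (hψs i i') hh1 hhK (Mφ := Mφ) (hφM i i') hNψ0 (hψN i i')
    rw [highLowQ'_eq, hMφ0] at hsharp
    refine hsharp.trans (add_le_add ?_ ?_)
    · -- top term: `(1+1)(‖Bs‖ δ)² E_K(ψ) ≤ 2 δ² CA A⁴ X2`
      have h1 : ENNReal.ofReal ((1 + 1) * (‖Bs‖ * δ) ^ 2) ≤ 2 * ENNReal.ofReal (δ ^ 2) := by
        rw [← ENNReal.ofReal_ofNat, ← ENNReal.ofReal_mul (by norm_num)]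
        refine ENNReal.ofReal_le_ofReal ?_
        have h2 : (‖Bs‖ * δ) ^ 2 ≤ δ ^ 2 := by
          rw [mul_pow]; exact mul_le_of_le_one_left (sq_nonneg _) (by nlinarith [norm_nonneg Bs])
        nlinarith
      calc _ ≤ 2 * ENNReal.ofReal (δ ^ 2) * (CA * ENNReal.ofReal ((Amax * Amax) ^ 2) * X2) := mul_le_mul' h1 (hψK i i')
        _ = _ := by ring
    · -- the rest
      have hB1 : ENNReal.ofReal (‖Bs‖ ^ 2) ≤ 1 := by
        rw [← ENNReal.ofReal_one]; exact ENNReal.ofReal_le_ofReal (by nlinarith [norm_nonneg Bs])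
      have hsup : ∑ j ∈ Finset.Ico 1 h, ENNReal.ofReal (Mφ j ^ 2) * sobolevEnergy (K - j) (ψ i i') ≤
          (h : ℝ≥0∞) * ENNReal.ofReal (Camax ^ 2) * (CA' * ENNReal.ofReal ((Amax * Amax) ^ 2)) * X1 := by
        calc _ ≤ ∑ _j ∈ Finset.Ico 1 h, ENNReal.ofReal (Camax ^ 2) * (CA' * ENNReal.ofReal ((Amax * Amax) ^ 2) * X1) := by
              refine Finset.sum_le_sum fun j hj ↦ ?_
              obtain ⟨hj1, hjh⟩ := Finset.mem_Ico.1 hj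
              rw [show Mφ j = Camax by simp [hMφ, (show j ≠ 0 by omega)]]
              exact mul_le_mul' le_rfl (hψlow i i' j hj1 hjh)
          _ ≤ (h : ℝ≥0∞) * (ENNReal.ofReal (Camax ^ 2) * (CA' * ENNReal.ofReal ((Amax * Amax) ^ 2) * X1)) := by
              rw [Finset.sum_const, nsmul_eq_mul, Nat.card_Ico]
              exact mul_le_mul' (by exact_mod_cast Nat.sub_le h 1) le_rfl
          _ = _ := by ring
      have hL2 : ENNReal.ofReal (Nψ ^ 2) * ∑ j ∈ Finset.Ico h (K + 1), sobolevEnergy j (φ i i') ≤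
          ENNReal.ofReal (Nψ ^ 2) * ((K + 1 : ℕ) : ℝ≥0∞) * Ccmax * (1 + Slow) * (1 + X1) := by
        calc _ ≤ ENNReal.ofReal (Nψ ^ 2) * ∑ _j ∈ Finset.Ico h (K + 1), Ccmax * (1 + Slow * X1) := by
              refine mul_le_mul' le_rfl (Finset.sum_le_sum fun j hj ↦ hφE i i' j (Nat.lt_succ_iff.1 (Finset.mem_Ico.1 hj).2))
          _ ≤ ENNReal.ofReal (Nψ ^ 2) * (((K + 1 : ℕ) : ℝ≥0∞) * (Ccmax * (1 + Slow * X1))) := by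
              rw [Finset.sum_const, nsmul_eq_mul, Nat.card_Ico]
              exact mul_le_mul' le_rfl (mul_le_mul' (by exact_mod_cast (show K + 1 - h ≤ K + 1 by omega)) le_rfl)
          _ ≤ ENNReal.ofReal (Nψ ^ 2) * (((K + 1 : ℕ) : ℝ≥0∞) * (Ccmax * ((1 + Slow) * (1 + X1)))) := by
              gcongr
              calc 1 + Slow * X1 ≤ 1 + Slow * X1 + (X1 + Slow) := le_self_add
                _ = (1 + Slow) * (1 + X1) := by ring
          _ = _ := by ring
      calc Chl * ENNReal.ofReal (‖Bs‖ ^ 2) * ((∑ j ∈ Finset.Ico 1 h, ENNReal.ofReal (Mφ j ^ 2) * sobolevEnergy (K - j) (ψ i i')) +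
            ENNReal.ofReal (Nψ ^ 2) * ∑ j ∈ Finset.Ico h (K + 1), sobolevEnergy j (φ i i'))
          ≤ Chl * 1 * ((h : ℝ≥0∞) * ENNReal.ofReal (Camax ^ 2) * (CA' * ENNReal.ofReal ((Amax * Amax) ^ 2)) * X1 +
              ENNReal.ofReal (Nψ ^ 2) * ((K + 1 : ℕ) : ℝ≥0∞) * Ccmax * (1 + Slow) * (1 + X1)) :=
            mul_le_mul' (mul_le_mul' le_rfl hB1) (add_le_add hsup hL2)
        _ ≤ Chl * 1 * ((h : ℝ≥0∞) * ENNReal.ofReal (Camax ^ 2) * (CA' * ENNReal.ofReal ((Amax * Amax) ^ 2)) * (1 + X1) +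
              ENNReal.ofReal (Nψ ^ 2) * ((K + 1 : ℕ) : ℝ≥0∞) * Ccmax * (1 + Slow) * (1 + X1)) := by
            gcongr; exact le_add_self
        _ = Bpair * (1 + X1) := by rw [hBpair]; ring
  /- ## assembly -/
  -- the top sum
  set T : E' → W := fun y ↦ ∑ i, ∑ i', φ i i' y • ψ i i' y with hT
  have hTs : ContDiff ℝ ∞ T := ContDiff.sum fun i _ ↦ ContDiff.sum fun i' _ ↦ (hφs i i').smul (hψs i i')
  have hTE : sobolevEnergy K T ≤ cι * cι * (cι * cι) * ((2 * CA * ENNReal.ofReal ((Amax * Amax) ^ 2)) * ENNReal.ofReal (δ ^ 2) * X2 + Bpair * (1 + X1)) := by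
    have h1 : sobolevEnergy K T ≤ cι * ∑ i, sobolevEnergy K (fun y ↦ ∑ i', φ i i' y • ψ i i' y) := by
      have h := sobolevEnergy_sum_le_card K Finset.univ (f := fun i y ↦ ∑ i', φ i i' y • ψ i i' y)
        fun i _ ↦ (ContDiff.sum fun i' _ ↦ (hφs i i').smul (hψs i i')).of_le (by exact_mod_cast le_top)
      rw [Finset.card_univ] at h
      exact h
    have h2 : ∀ i, sobolevEnergy K (fun y ↦ ∑ i', φ i i' y • ψ i i' y) ≤ cι * ∑ i', sobolevEnergy K (fun y ↦ φ i i' y • ψ i i' y) := by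
      intro i
      have h := sobolevEnergy_sum_le_card K Finset.univ (f := fun i' y ↦ φ i i' y • ψ i i' y) fun i' _ ↦ ((hφs i i').smul (hψs i i')).of_le (by exact_mod_cast le_top)
      rw [Finset.card_univ] at h
      exact h
    calc sobolevEnergy K T ≤ cι * ∑ i, (cι * ∑ i', sobolevEnergy K (fun y ↦ φ i i' y • ψ i i' y)) := h1.trans (mul_le_mul' le_rfl (Finset.sum_le_sum fun i _ ↦ h2 i))
      _ ≤ cι * ∑ _i : ι, (cι * ∑ _i' : ι, ((2 * CA * ENNReal.ofReal ((Amax * Amax) ^ 2)) * ENNReal.ofReal (δ ^ 2) * X2 + Bpair * (1 + X1))) :=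
          mul_le_mul' le_rfl (Finset.sum_le_sum fun i _ ↦ mul_le_mul' le_rfl (Finset.sum_le_sum fun i' _ ↦ hprod i i'))
      _ = _ := by rw [Finset.sum_const, Finset.sum_const, Finset.card_univ, nsmul_eq_mul, nsmul_eq_mul, hcι]; ring
  -- the remainder composite
  have hRr : sobolevEnergy K (jetComp Gr 𝔷) ≤ Cr * (1 + Slow) * (1 + X1) := by
    refine (hCr h𝔷s (fun m hm y ↦ h𝔷b m (by omega) y) K le_rfl).trans ?_
    calc Cr * (1 + ∑ m ∈ Finset.range (K + 1), sobolevEnergy m 𝔷) ≤ Cr * (1 + Slow * X1) := mul_le_mul' le_rfl (add_le_add le_rfl (h𝔷E K le_rfl))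
      _ ≤ Cr * ((1 + Slow) * (1 + X1)) := by
          gcongr
          calc 1 + Slow * X1 ≤ 1 + Slow * X1 + (X1 + Slow) := le_self_add
            _ = (1 + Slow) * (1 + X1) := by ring
      _ = _ := by ring
  -- the cut-off multiplication
  have hcutb : ∀ y, |cut y| ≤ Mcut := fun y ↦ by
    have h := hMcut 0 (Nat.zero_le _) y
    rwa [norm_iteratedFDeriv_zero, Real.norm_eq_abs] at h
  have hcutw : ∀ l : List (Fin (Module.finrank ℝ E')), l ≠ [] → l.length ≤ K → ∀ y, ‖iterDirDeriv (l.map (stdOrthonormalBasis ℝ E')) cut y‖ ≤ Mcut := by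
    intro l _ hl y
    have h := norm_iterDirDeriv_le hcut (l.map (stdOrthonormalBasis ℝ E')) y
    have hprod : ∏ i, ‖(l.map (stdOrthonormalBasis ℝ E')).get i‖ = 1 := Finset.prod_eq_one fun i _ ↦ by simp [(stdOrthonormalBasis ℝ E').orthonormal.1]
    rw [hprod, mul_one, List.length_map] at h
    exact h.trans (hMcut _ hl y)
  have hinner : ContDiff ℝ ∞ fun y ↦ T y + jetComp Gr 𝔷 y := hTs.add (contDiff_jetComp hGr h𝔷s)
  have hcutE : sobolevEnergy K (fun y ↦ cut y • (T y + jetComp Gr 𝔷 y)) ≤ Ccut * ENNReal.ofReal (Mcut ^ 2) * (2 * sobolevEnergy K T + 2 * sobolevEnergy K (jetComp Gr 𝔷)) :=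
    (hCcut hcut hinner hcutb hcutw).trans (mul_le_mul' le_rfl (sobolevEnergy_add_le K (hTs.of_le (by exact_mod_cast le_top))
      ((contDiff_jetComp hGr h𝔷s).of_le (by exact_mod_cast le_top))))
  have heq : thetaFlat Av cut Gc Gr g₀ z = fun y ↦ cut y • (T y + jetComp Gr 𝔷 y) + g₀ y := by
    funext y; simp only [thetaFlat, hT, hφ, hψ, h𝔷, jetComp_apply]
  rw [heq]
  refine (sobolevEnergy_add_le K ((hcut.smul hinner).of_le (by exact_mod_cast le_top)) (hg₀.of_le (by exact_mod_cast le_top))).trans ?_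
  calc 2 * sobolevEnergy K (fun y ↦ cut y • (T y + jetComp Gr 𝔷 y)) + 2 * sobolevEnergy K g₀
      ≤ 2 * (Ccut * ENNReal.ofReal (Mcut ^ 2) * (2 * (cι * cι * (cι * cι) * ((2 * CA * ENNReal.ofReal ((Amax * Amax) ^ 2)) * ENNReal.ofReal (δ ^ 2) * X2 + Bpair * (1 + X1))) +
          2 * (Cr * (1 + Slow) * (1 + X1)))) + 2 * sobolevEnergy K g₀ :=
        add_le_add (mul_le_mul' le_rfl (hcutE.trans (mul_le_mul' le_rfl (add_le_add (mul_le_mul' le_rfl hTE) (mul_le_mul' le_rfl hRr))))) le_rfl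
    _ ≤ Ctop * ENNReal.ofReal (δ ^ 2) * X2 + B * (1 + X1) := by
        rw [hCtop, hB]
        have hg1 : 2 * sobolevEnergy K g₀ ≤ 2 * sobolevEnergy K g₀ * (1 + X1) := le_mul_of_one_le_right' le_self_add
        calc _ = 2 * (Ccut * ENNReal.ofReal (Mcut ^ 2)) * (2 * (cι * cι * (cι * cι))) * (2 * CA * ENNReal.ofReal ((Amax * Amax) ^ 2)) * ENNReal.ofReal (δ ^ 2) * X2 +
              (2 * (Ccut * ENNReal.ofReal (Mcut ^ 2)) * (2 * (cι * cι * (cι * cι)) * Bpair + 2 * (Cr * (1 + Slow))) * (1 + X1) + 2 * sobolevEnergy K g₀) := by ring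
          _ ≤ _ := by
              rw [add_mul _ (2 * sobolevEnergy K g₀) (1 + X1)]
              exact add_le_add le_rfl (add_le_add le_rfl hg1)

/-! ### The difference estimate (contraction form) -/

omit [FiniteDimensional ℝ E'] [MeasurableSpace E'] [BorelSpace E'] [FiniteDimensional ℝ W] in
/-- The jet is linear: `𝔷(z) - 𝔷(z') = 𝔷(z - z')`. [folklore] -/
theorem jetOf_sub {z z' : E' → W} (hz : ContDiff ℝ ∞ z) (hz' : ContDiff ℝ ∞ z') :
    (fun y ↦ jetOf z y - jetOf z' y) = jetOf fun y ↦ z y - z' y := by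
  funext y
  have hd : DifferentiableAt ℝ z y := (hz.differentiable (by simp)) y
  have hd' : DifferentiableAt ℝ z' y := (hz'.differentiable (by simp)) y
  simp only [jetOf_apply, Prod.mk_sub_mk, fderiv_fun_sub hd hd']

set_option maxHeartbeats 1600000 in
/-- **The flat energy estimate (difference form).** For the data of the flat Picard source and
every order `K` there is `C_top < ∞`, and for every `R` there is `B < ∞`, such that for all
smooth compactly supported `z, z'` with `‖Dᵐ z‖, ‖Dᵐ z'‖ ≤ R` (`m ≤ K + 2`) and `δ ≥ 0` bounding
`|Gᶜᵢᵢ'(y, 𝔷 y)|`: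
`E_K(Θ♭(z) - Θ♭(z')) ≤ C_top δ² E_{K+2}(z - z') + B E_{K+1}(z - z')`.
[cite: TaylorPDEIII2011, Ch. 15, §7] -/
theorem energy_thetaFlat_sub_le (Av : ι → E') (K : ℕ) {cut : E' → ℝ} (hcut : ContDiff ℝ ∞ cut) (hcutc : HasCompactSupport cut)
    {Gc : ι → ι → (E' × (W × (E' →L[ℝ] W)) → ℝ)} (hGc : ∀ i i', ContDiff ℝ ∞ (Gc i i')) (hGcc : ∀ i i', HasCompactSupport (Gc i i'))
    {Gr : E' × (W × (E' →L[ℝ] W)) → W} (hGr : ContDiff ℝ ∞ Gr) (hGrc : HasCompactSupport Gr) (g₀ : E' → W) :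
    ∃ Ctop : ℝ≥0∞, Ctop ≠ ⊤ ∧ ∀ R : ℝ, ∃ B : ℝ≥0∞, B ≠ ⊤ ∧ ∀ {z z' : E' → W}, ContDiff ℝ ∞ z → ContDiff ℝ ∞ z' →
      (∀ m ≤ K + 2, ∀ y, ‖iteratedFDeriv ℝ m z y‖ ≤ R) → (∀ m ≤ K + 2, ∀ y, ‖iteratedFDeriv ℝ m z' y‖ ≤ R) →
      ∀ {δ : ℝ}, 0 ≤ δ → (∀ i i' y, |Gc i i' (y, jetOf z y)| ≤ δ) →
      sobolevEnergy K (fun y ↦ thetaFlat Av cut Gc Gr g₀ z y - thetaFlat Av cut Gc Gr g₀ z' y) ≤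
        Ctop * ENNReal.ofReal (δ ^ 2) * sobolevEnergy (K + 2) (fun y ↦ z y - z' y) + B * sobolevEnergy (K + 1) (fun y ↦ z y - z' y) := by
  classical
  /- ## fixed constants -/
  obtain ⟨Mcut, hMcut0, hMcut⟩ := exists_forall_norm_iteratedFDeriv_le hcut hcutc K
  obtain ⟨Ccut, hCcuttop, hCcut⟩ := sobolevEnergy_smul_le_crude (E := E') (F := W) K
  obtain ⟨CA, hCAtop, hCA⟩ := sobolevEnergy_hessComp_le (E' := E') (W := W) K
  obtain ⟨CA', hCA'top, hCA'⟩ := sobolevEnergy_hessComp_le (E' := E') (W := W) (K - 1)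
  obtain ⟨Chl, hChltop, hChl⟩ := sobolevEnergy_bilinear_highlow_sharp (E := E') (G₁ := ℝ) (G₂ := W) (F := W) K (ε := 1) one_pos le_rfl
  obtain ⟨Cf, hCftop, hCf⟩ := sobolevEnergy_fderiv_le (E' := E') (V := W) K
  obtain ⟨Cp, hCptop, hCp⟩ := sobolevEnergy_le_of_pointwise₂ (E := E') (F₁ := W) (F₂ := W × (E' →L[ℝ] W)) K
  set Amax : ℝ := ∑ i, ‖Av i‖ with hAmax
  have hAmax0 : 0 ≤ Amax := Finset.sum_nonneg fun i _ ↦ norm_nonneg _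
  have hAi : ∀ i, ‖Av i‖ ≤ Amax := fun i ↦ Finset.single_le_sum (f := fun i ↦ ‖Av i‖) (fun _ _ ↦ norm_nonneg _) (Finset.mem_univ i)
  set cι : ℝ≥0∞ := (Fintype.card ι : ℝ≥0∞) with hcι
  set Ctop : ℝ≥0∞ := Ccut * ENNReal.ofReal (Mcut ^ 2) * (2 * (cι * cι * (2 * (cι * cι)))) * (2 * CA * ENNReal.ofReal ((Amax * Amax) ^ 2)) with hCtop
  refine ⟨Ctop, ?_, fun R ↦ ?_⟩
  · simp only [hCtop]
    exact ENNReal.mul_ne_top (ENNReal.mul_ne_top (ENNReal.mul_ne_top hCcuttop ENNReal.ofReal_ne_top)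
      (ENNReal.mul_ne_top (by simp) (ENNReal.mul_ne_top (ENNReal.mul_ne_top (ENNReal.natCast_ne_top _) (ENNReal.natCast_ne_top _))
        (ENNReal.mul_ne_top (by simp) (ENNReal.mul_ne_top (ENNReal.natCast_ne_top _) (ENNReal.natCast_ne_top _))))))
      (ENNReal.mul_ne_top (ENNReal.mul_ne_top (by simp) hCAtop) ENNReal.ofReal_ne_top)
  /- ## constants depending on `R` -/
  -- sup bounds of all derivatives up to `K` of the coefficient composites (jets bounded by `2R` up to order `K`)
  have ha := fun i i' ↦ norm_iteratedFDeriv_jetComp_le K (hGc i i') (hGcc i i') (|R| + |R|)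
  choose Ca hCa0 hCa using ha
  set Camax : ℝ := ∑ i, ∑ i', Ca i i' with hCamax
  have hCamax0 : 0 ≤ Camax := Finset.sum_nonneg fun i _ ↦ Finset.sum_nonneg fun i' _ ↦ hCa0 i i'
  have hCai : ∀ i i', Ca i i' ≤ Camax := fun i i' ↦ (Finset.single_le_sum (f := fun i' ↦ Ca i i') (fun _ _ ↦ hCa0 i _) (Finset.mem_univ i')).trans
    (Finset.single_le_sum (f := fun i ↦ ∑ i', Ca i i') (fun _ _ ↦ Finset.sum_nonneg fun _ _ ↦ hCa0 _ _) (Finset.mem_univ i))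
  -- pointwise difference constants
  have hd := fun i i' ↦ norm_iteratedFDeriv_jetComp_sub_le K (hGc i i') (hGcc i i') (|R| + |R|)
  choose Cd hCd0 hCd using hd
  set Cdmax : ℝ := ∑ i, ∑ i', Cd i i' with hCdmax
  have hCdmax0 : 0 ≤ Cdmax := Finset.sum_nonneg fun i _ ↦ Finset.sum_nonneg fun i' _ ↦ hCd0 i i'
  have hCdi : ∀ i i', Cd i i' ≤ Cdmax := fun i i' ↦ (Finset.single_le_sum (f := fun i' ↦ Cd i i') (fun _ _ ↦ hCd0 i _) (Finset.mem_univ i')).trans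
    (Finset.single_le_sum (f := fun i ↦ ∑ i', Cd i i') (fun _ _ ↦ Finset.sum_nonneg fun _ _ ↦ hCd0 _ _) (Finset.mem_univ i))
  obtain ⟨Cdr, hCdr0, hCdr⟩ := norm_iteratedFDeriv_jetComp_sub_le K hGr hGrc (|R| + |R|)
  -- the `R`-constant
  set Slow : ℝ≥0∞ := ((K + 1 : ℕ) : ℝ≥0∞) * (1 + Cf) with hSlow
  have hSlowtop : Slow ≠ ⊤ := ENNReal.mul_ne_top (ENNReal.natCast_ne_top _) (ENNReal.add_ne_top.2 ⟨ENNReal.one_ne_top, hCftop⟩)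
  set BA : ℝ≥0∞ := Chl * ((K : ℝ≥0∞) * ENNReal.ofReal (Camax ^ 2) * (CA' * ENNReal.ofReal ((Amax * Amax) ^ 2))) with hBA
  have hBAtop : BA ≠ ⊤ := ENNReal.mul_ne_top hChltop (ENNReal.mul_ne_top (ENNReal.mul_ne_top (ENNReal.natCast_ne_top _) ENNReal.ofReal_ne_top)
    (ENNReal.mul_ne_top hCA'top ENNReal.ofReal_ne_top))
  set BB : ℝ≥0∞ := Cp * ENNReal.ofReal ((2 ^ K * Cdmax * (Amax * Amax * |R|)) ^ 2) * Slow with hBB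
  have hBBtop : BB ≠ ⊤ := ENNReal.mul_ne_top (ENNReal.mul_ne_top hCptop ENNReal.ofReal_ne_top) hSlowtop
  set BC : ℝ≥0∞ := Cp * ENNReal.ofReal (Cdr ^ 2) * Slow with hBC
  have hBCtop : BC ≠ ⊤ := ENNReal.mul_ne_top (ENNReal.mul_ne_top hCptop ENNReal.ofReal_ne_top) hSlowtop
  set B : ℝ≥0∞ := Ccut * ENNReal.ofReal (Mcut ^ 2) * (2 * (cι * cι * (2 * (cι * cι) * (BA + BB))) + 2 * BC) with hB
  refine ⟨B, ?_, fun {z z'} hz hz' hR hR' δ hδ0 hδ ↦ ?_⟩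
  · exact ENNReal.mul_ne_top (ENNReal.mul_ne_top hCcuttop ENNReal.ofReal_ne_top) (ENNReal.add_ne_top.2
      ⟨ENNReal.mul_ne_top (by simp) (ENNReal.mul_ne_top (ENNReal.mul_ne_top (ENNReal.natCast_ne_top _) (ENNReal.natCast_ne_top _))
        (ENNReal.mul_ne_top (ENNReal.mul_ne_top (by simp) (ENNReal.mul_ne_top (ENNReal.natCast_ne_top _) (ENNReal.natCast_ne_top _)))
          (ENNReal.add_ne_top.2 ⟨hBAtop, hBBtop⟩))), ENNReal.mul_ne_top (by simp) hBCtop⟩)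
  /- ## the pieces -/
  obtain ⟨w, hw⟩ : ∃ w : E' → W, w = fun y ↦ z y - z' y := ⟨_, rfl⟩
  rw [← hw]
  have hws : ContDiff ℝ ∞ w := by rw [hw]; exact hz.sub hz'
  obtain ⟨𝔷, h𝔷⟩ : ∃ 𝔷 : E' → W × (E' →L[ℝ] W), 𝔷 = jetOf z := ⟨_, rfl⟩
  obtain ⟨𝔷', h𝔷'⟩ : ∃ 𝔷' : E' → W × (E' →L[ℝ] W), 𝔷' = jetOf z' := ⟨_, rfl⟩
  have h𝔷s : ContDiff ℝ ∞ 𝔷 := by rw [h𝔷]; exact contDiff_jetOf hz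
  have h𝔷's : ContDiff ℝ ∞ 𝔷' := by rw [h𝔷']; exact contDiff_jetOf hz'
  have h𝔷w : (fun y ↦ 𝔷 y - 𝔷' y) = jetOf w := by rw [h𝔷, h𝔷', hw]; exact jetOf_sub hz hz'
  have hDD : ContDiff ℝ ∞ (fderiv ℝ (fderiv ℝ z)) := (hz.fderiv_right (m := ∞) (by norm_cast)).fderiv_right (m := ∞) (by norm_cast)
  have hDD' : ContDiff ℝ ∞ (fderiv ℝ (fderiv ℝ z')) := (hz'.fderiv_right (m := ∞) (by norm_cast)).fderiv_right (m := ∞) (by norm_cast)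
  have hDDw : ContDiff ℝ ∞ (fderiv ℝ (fderiv ℝ w)) := (hws.fderiv_right (m := ∞) (by norm_cast)).fderiv_right (m := ∞) (by norm_cast)
  -- jet bounds up to order `K + 1` (hence `K`)
  have h𝔷b : ∀ m ≤ K, ∀ y, ‖iteratedFDeriv ℝ m 𝔷 y‖ ≤ |R| + |R| := fun m hm y ↦ by
    rw [h𝔷]; exact (norm_iteratedFDeriv_jetOf_le hz m y).trans (add_le_add ((hR m (by omega) y).trans (le_abs_self R)) ((hR (m + 1) (by omega) y).trans (le_abs_self R)))
  have h𝔷'b : ∀ m ≤ K, ∀ y, ‖iteratedFDeriv ℝ m 𝔷' y‖ ≤ |R| + |R| := fun m hm y ↦ by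
    rw [h𝔷']; exact (norm_iteratedFDeriv_jetOf_le hz' m y).trans (add_le_add ((hR' m (by omega) y).trans (le_abs_self R)) ((hR' (m + 1) (by omega) y).trans (le_abs_self R)))
  set X1 := sobolevEnergy (K + 1) w with hX1
  set X2 := sobolevEnergy (K + 2) w with hX2
  -- energies of the jet of the difference: `Σ_{m ≤ K} E_m(𝔷 - 𝔷') ≤ Slow X1`
  have h𝔷E : ∑ m ∈ Finset.range (K + 1), sobolevEnergy m (jetOf w) ≤ Slow * X1 := by
    calc _ ≤ ∑ _m ∈ Finset.range (K + 1), (sobolevEnergy K w + sobolevEnergy K (fderiv ℝ w)) := by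
          refine Finset.sum_le_sum fun m hm ↦ ?_
          have hm' : m ≤ K := Nat.lt_succ_iff.1 (Finset.mem_range.1 hm)
          exact (sobolevEnergy_jetOf_le m hws).trans (add_le_add (sobolevEnergy_mono hm' _) (sobolevEnergy_mono hm' _))
      _ = ((K + 1 : ℕ) : ℝ≥0∞) * (sobolevEnergy K w + sobolevEnergy K (fderiv ℝ w)) := by rw [Finset.sum_const, Finset.card_range, nsmul_eq_mul]
      _ ≤ ((K + 1 : ℕ) : ℝ≥0∞) * (X1 + Cf * X1) := mul_le_mul' le_rfl (add_le_add (sobolevEnergy_mono (Nat.le_succ K) w) (hCf hws))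
      _ = Slow * X1 := by rw [hSlow]; ring
  -- Hessian components
  obtain ⟨ψ, hψ⟩ : ∃ ψ : ι → ι → E' → W, ψ = fun i i' y ↦ fderiv ℝ (fderiv ℝ z) y (Av i) (Av i') := ⟨_, rfl⟩
  obtain ⟨ψ', hψ'⟩ : ∃ ψ' : ι → ι → E' → W, ψ' = fun i i' y ↦ fderiv ℝ (fderiv ℝ z') y (Av i) (Av i') := ⟨_, rfl⟩
  obtain ⟨ψw, hψw⟩ : ∃ ψw : ι → ι → E' → W, ψw = fun i i' y ↦ fderiv ℝ (fderiv ℝ w) y (Av i) (Av i') := ⟨_, rfl⟩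
  have hψs : ∀ i i', ContDiff ℝ ∞ (ψ i i') := fun i i' ↦ by rw [hψ]; exact (hDD.clm_apply contDiff_const).clm_apply contDiff_const
  have hψ's : ∀ i i', ContDiff ℝ ∞ (ψ' i i') := fun i i' ↦ by rw [hψ']; exact (hDD'.clm_apply contDiff_const).clm_apply contDiff_const
  have hψws : ∀ i i', ContDiff ℝ ∞ (ψw i i') := fun i i' ↦ by rw [hψw]; exact (hDDw.clm_apply contDiff_const).clm_apply contDiff_const
  have hψsub : ∀ i i', (fun y ↦ ψ i i' y - ψ' i i' y) = ψw i i' := by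
    intro i i'; funext y
    have hev : fderiv ℝ w = fun y ↦ fderiv ℝ z y - fderiv ℝ z' y := by
      funext y; rw [hw]; exact fderiv_fun_sub ((hz.differentiable (by simp)) y) ((hz'.differentiable (by simp)) y)
    simp only [hψ, hψ', hψw, hev]
    rw [fderiv_fun_sub (((hz.fderiv_right (m := ∞) (by norm_cast)).differentiable (by simp)) y) (((hz'.fderiv_right (m := ∞) (by norm_cast)).differentiable (by simp)) y)]
    rfl
  have hA4 : ∀ i i', ENNReal.ofReal ((‖Av i‖ * ‖Av i'‖) ^ 2) ≤ ENNReal.ofReal ((Amax * Amax) ^ 2) := fun i i' ↦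
    ENNReal.ofReal_le_ofReal (pow_le_pow_left₀ (by positivity) (mul_le_mul (hAi i) (hAi i') (norm_nonneg _) hAmax0) 2)
  have hψwK : ∀ i i', sobolevEnergy K (ψw i i') ≤ CA * ENNReal.ofReal ((Amax * Amax) ^ 2) * X2 := fun i i' ↦ by
    rw [hψw]; exact (hCA hws (Av i) (Av i')).trans (mul_le_mul' (mul_le_mul' le_rfl (hA4 i i')) le_rfl)
  have hψwlow : ∀ i i', ∀ j, 1 ≤ j → j ≤ K → sobolevEnergy (K - j) (ψw i i') ≤ CA' * ENNReal.ofReal ((Amax * Amax) ^ 2) * X1 := by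
    intro i i' j hj1 hjK
    have h1 : sobolevEnergy (K - j) (ψw i i') ≤ sobolevEnergy (K - 1) (ψw i i') := sobolevEnergy_mono (by omega) _
    refine h1.trans ?_
    rw [hψw]
    refine (hCA' hws (Av i) (Av i')).trans ?_
    rw [show K - 1 + 2 = K + 1 by omega]
    exact mul_le_mul' (mul_le_mul' le_rfl (hA4 i i')) le_rfl
  -- sup bounds of all derivatives up to `K` of `ψ'`
  have hψ'N : ∀ i i', ∀ m ≤ K, ∀ y, ‖iteratedFDeriv ℝ m (ψ' i i') y‖ ≤ Amax * Amax * |R| := by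
    intro i i' m hm y
    have h1 := norm_iteratedFDeriv_clm_apply_const (f := fun y ↦ fderiv ℝ (fderiv ℝ z') y (Av i)) (c := Av i') (x := y) (N := ∞) (n := m)
      ((hDD'.clm_apply contDiff_const).contDiffAt) (by exact_mod_cast le_top)
    have h2 := norm_iteratedFDeriv_clm_apply_const (f := fderiv ℝ (fderiv ℝ z')) (c := Av i) (x := y) (N := ∞) (n := m)
      hDD'.contDiffAt (by exact_mod_cast le_top)
    have h3 : ‖iteratedFDeriv ℝ m (fderiv ℝ (fderiv ℝ z')) y‖ ≤ |R| := by
      rw [norm_iteratedFDeriv_fderiv, norm_iteratedFDeriv_fderiv]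
      exact (hR' (m + 1 + 1) (by omega) y).trans (le_abs_self R)
    calc ‖iteratedFDeriv ℝ m (ψ' i i') y‖ ≤ ‖Av i'‖ * ‖iteratedFDeriv ℝ m (fun y ↦ fderiv ℝ (fderiv ℝ z') y (Av i)) y‖ := by rw [hψ']; exact h1
      _ ≤ ‖Av i'‖ * (‖Av i‖ * ‖iteratedFDeriv ℝ m (fderiv ℝ (fderiv ℝ z')) y‖) := mul_le_mul_of_nonneg_left h2 (norm_nonneg _)
      _ ≤ Amax * (Amax * |R|) := mul_le_mul (hAi i') (mul_le_mul (hAi i) h3 (norm_nonneg _) hAmax0) (by positivity) hAmax0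
      _ = Amax * Amax * |R| := by ring
  -- the coefficient composites and their differences
  obtain ⟨φ, hφ⟩ : ∃ φ : ι → ι → E' → ℝ, φ = fun i i' ↦ jetComp (Gc i i') 𝔷 := ⟨_, rfl⟩
  obtain ⟨φ', hφ'⟩ : ∃ φ' : ι → ι → E' → ℝ, φ' = fun i i' ↦ jetComp (Gc i i') 𝔷' := ⟨_, rfl⟩
  have hφs : ∀ i i', ContDiff ℝ ∞ (φ i i') := fun i i' ↦ by rw [hφ]; exact contDiff_jetComp (hGc i i') h𝔷s
  have hφ's : ∀ i i', ContDiff ℝ ∞ (φ' i i') := fun i i' ↦ by rw [hφ']; exact contDiff_jetComp (hGc i i') h𝔷's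
  obtain ⟨Mφ, hMφ⟩ : ∃ Mφ : ℕ → ℝ, Mφ = fun j ↦ if j = 0 then δ else Camax := ⟨_, rfl⟩
  have hMφ0 : Mφ 0 = δ := by simp [hMφ]
  have hφM : ∀ i i', ∀ j < K + 1, ∀ y, ‖iteratedFDeriv ℝ j (φ i i') y‖ ≤ Mφ j := by
    intro i i' j hj y
    rcases Nat.eq_zero_or_pos j with rfl | hjpos
    · rw [hMφ0, norm_iteratedFDeriv_zero, Real.norm_eq_abs, hφ, h𝔷]
      exact hδ i i' y
    · rw [show Mφ j = Camax by simp [hMφ, hjpos.ne'], hφ]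
      exact (hCa i i' h𝔷s h𝔷b j (by omega) y).trans (hCai i i')
  have hφd : ∀ i i', ∀ m ≤ K, ∀ y, ‖iteratedFDeriv ℝ m (fun x ↦ φ i i' x - φ' i i' x) y‖ ≤ Cdmax * ∑ l ∈ Finset.range (m + 1), ‖iteratedFDeriv ℝ l (jetOf w) y‖ := by
    intro i i' m hm y
    have h := hCd i i' h𝔷s h𝔷's h𝔷b h𝔷'b m hm y
    rw [h𝔷w] at h
    rw [hφ, hφ']
    exact h.trans (mul_le_mul_of_nonneg_right (hCdi i i') (Finset.sum_nonneg fun _ _ ↦ norm_nonneg _))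
  /- ## Term A: `φ • (ψ - ψ')` by the sharp bound, all of `φ` in sup -/
  obtain ⟨Bs, hBs⟩ : ∃ Bs : ℝ →L[ℝ] W →L[ℝ] W, Bs = ContinuousLinearMap.lsmul ℝ ℝ := ⟨_, rfl⟩
  have hBsapp : ∀ (r : ℝ) (x : W), Bs r x = r • x := fun r x ↦ by rw [hBs]; rfl
  have hBsn : ‖Bs‖ ≤ 1 := by rw [hBs]; exact ContinuousLinearMap.opNorm_lsmul_le
  have hTA : ∀ i i', sobolevEnergy K (fun y ↦ φ i i' y • ψw i i' y) ≤ (2 * CA * ENNReal.ofReal ((Amax * Amax) ^ 2)) * ENNReal.ofReal (δ ^ 2) * X2 + BA * X1 := by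
    intro i i'
    have hfun : (fun y ↦ φ i i' y • ψw i i' y) = fun y ↦ Bs (φ i i' y) (ψw i i' y) := by funext y; rw [hBsapp]
    rw [hfun]
    have hsharp := hChl Bs (hφs i i') (hψws i i') (h := K + 1) (by omega) le_rfl (Mφ := Mφ) (Nψ := 0) (hφM i i') le_rfl
      (fun m hm y ↦ absurd hm (by omega))
    rw [highLowQ'_eq, hMφ0] at hsharp
    refine hsharp.trans (add_le_add ?_ ?_)
    · have h1 : ENNReal.ofReal ((1 + 1) * (‖Bs‖ * δ) ^ 2) ≤ 2 * ENNReal.ofReal (δ ^ 2) := by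
        rw [← ENNReal.ofReal_ofNat, ← ENNReal.ofReal_mul (by norm_num)]
        refine ENNReal.ofReal_le_ofReal ?_
        have h2 : (‖Bs‖ * δ) ^ 2 ≤ δ ^ 2 := by rw [mul_pow]; exact mul_le_of_le_one_left (sq_nonneg _) (by nlinarith [norm_nonneg Bs])
        nlinarith
      calc _ ≤ 2 * ENNReal.ofReal (δ ^ 2) * (CA * ENNReal.ofReal ((Amax * Amax) ^ 2) * X2) := mul_le_mul' h1 (hψwK i i')
        _ = _ := by ring
    · have hB1 : ENNReal.ofReal (‖Bs‖ ^ 2) ≤ 1 := by rw [← ENNReal.ofReal_one]; exact ENNReal.ofReal_le_ofReal (by nlinarith [norm_nonneg Bs])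
      have hsup : ∑ j ∈ Finset.Ico 1 (K + 1), ENNReal.ofReal (Mφ j ^ 2) * sobolevEnergy (K - j) (ψw i i') ≤
          (K : ℝ≥0∞) * ENNReal.ofReal (Camax ^ 2) * (CA' * ENNReal.ofReal ((Amax * Amax) ^ 2)) * X1 := by
        calc _ ≤ ∑ _j ∈ Finset.Ico 1 (K + 1), ENNReal.ofReal (Camax ^ 2) * (CA' * ENNReal.ofReal ((Amax * Amax) ^ 2) * X1) := by
              refine Finset.sum_le_sum fun j hj ↦ ?_
              obtain ⟨hj1, hjK⟩ := Finset.mem_Ico.1 hj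
              rw [show Mφ j = Camax by simp [hMφ, (show j ≠ 0 by omega)]]
              exact mul_le_mul' le_rfl (hψwlow i i' j hj1 (by omega))
          _ = (K : ℝ≥0∞) * (ENNReal.ofReal (Camax ^ 2) * (CA' * ENNReal.ofReal ((Amax * Amax) ^ 2) * X1)) := by
              rw [Finset.sum_const, nsmul_eq_mul, Nat.card_Ico, Nat.add_sub_cancel]
          _ = _ := by ring
      have hempty : ENNReal.ofReal ((0 : ℝ) ^ 2) * ∑ j ∈ Finset.Ico (K + 1) (K + 1), sobolevEnergy j (φ i i') = 0 := by simp
      rw [hempty, add_zero]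
      calc Chl * ENNReal.ofReal (‖Bs‖ ^ 2) * ∑ j ∈ Finset.Ico 1 (K + 1), ENNReal.ofReal (Mφ j ^ 2) * sobolevEnergy (K - j) (ψw i i')
          ≤ Chl * 1 * ((K : ℝ≥0∞) * ENNReal.ofReal (Camax ^ 2) * (CA' * ENNReal.ofReal ((Amax * Amax) ^ 2)) * X1) := mul_le_mul' (mul_le_mul' le_rfl hB1) hsup
        _ = BA * X1 := by rw [hBA]; ring
  /- ## Term B: `(φ - φ') • ψ'` pointwise -/
  have hTB : ∀ i i', sobolevEnergy K (fun y ↦ (φ i i' y - φ' i i' y) • ψ' i i' y) ≤ BB * X1 := by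
    intro i i'
    have hsm : ContDiff ℝ ∞ fun y ↦ (φ i i' y - φ' i i' y) • ψ' i i' y := ((hφs i i').sub (hφ's i i')).smul (hψ's i i')
    have hdom : ∀ m ≤ K, ∀ y, ‖iteratedFDeriv ℝ m (fun y ↦ (φ i i' y - φ' i i' y) • ψ' i i' y) y‖ ≤
        (2 ^ K * Cdmax * (Amax * Amax * |R|)) * ∑ l ∈ Finset.range (m + 1), ‖iteratedFDeriv ℝ l (jetOf w) y‖ := by
      intro m hm y
      refine (norm_iteratedFDeriv_smul_le ((hφs i i').sub (hφ's i i')) (hψ's i i') y (n := m) (by exact_mod_cast le_top)).trans ?_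
      set S := ∑ l ∈ Finset.range (m + 1), ‖iteratedFDeriv ℝ l (jetOf w) y‖ with hS
      have hS0 : 0 ≤ S := Finset.sum_nonneg fun _ _ ↦ norm_nonneg _
      calc ∑ l ∈ Finset.range (m + 1), (m.choose l : ℝ) * ‖iteratedFDeriv ℝ l (fun x ↦ φ i i' x - φ' i i' x) y‖ * ‖iteratedFDeriv ℝ (m - l) (ψ' i i') y‖
          ≤ ∑ l ∈ Finset.range (m + 1), (m.choose l : ℝ) * (Cdmax * S) * (Amax * Amax * |R|) := by
            refine Finset.sum_le_sum fun l hl ↦ ?_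
            have hl' : l ≤ m := Nat.lt_succ_iff.1 (Finset.mem_range.1 hl)
            refine mul_le_mul (mul_le_mul_of_nonneg_left ((hφd i i' l (by omega) y).trans ?_) (Nat.cast_nonneg _)) (hψ'N i i' (m - l) (by omega) y)
              (norm_nonneg _) (mul_nonneg (Nat.cast_nonneg _) (mul_nonneg hCdmax0 hS0))
            exact mul_le_mul_of_nonneg_left (Finset.sum_le_sum_of_subset_of_nonneg (Finset.range_mono (by omega)) fun _ _ _ ↦ norm_nonneg _) hCdmax0
        _ = (2 ^ m * Cdmax * (Amax * Amax * |R|)) * S := by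
            rw [← Finset.sum_mul, ← Finset.sum_mul]
            have h' : ∑ l ∈ Finset.range (m + 1), (m.choose l : ℝ) = 2 ^ m := by exact_mod_cast Nat.sum_range_choose m
            rw [h']; ring
        _ ≤ (2 ^ K * Cdmax * (Amax * Amax * |R|)) * S := by
            refine mul_le_mul_of_nonneg_right ?_ hS0
            have h2 : (2 : ℝ) ^ m ≤ 2 ^ K := pow_le_pow_right₀ (by norm_num) hm
            have : 0 ≤ Cdmax * (Amax * Amax * |R|) := by positivity
            nlinarith
    refine (hCp hsm (contDiff_jetOf hws) (by positivity) hdom).trans ?_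
    calc Cp * ENNReal.ofReal ((2 ^ K * Cdmax * (Amax * Amax * |R|)) ^ 2) * ∑ l ∈ Finset.range (K + 1), sobolevEnergy l (jetOf w)
        ≤ Cp * ENNReal.ofReal ((2 ^ K * Cdmax * (Amax * Amax * |R|)) ^ 2) * (Slow * X1) := mul_le_mul' le_rfl h𝔷E
      _ = BB * X1 := by rw [hBB]; ring
  /- ## Term C: the remainder difference, pointwise -/
  have hTC : sobolevEnergy K (fun y ↦ jetComp Gr 𝔷 y - jetComp Gr 𝔷' y) ≤ BC * X1 := by
    have hsm : ContDiff ℝ ∞ fun y ↦ jetComp Gr 𝔷 y - jetComp Gr 𝔷' y := (contDiff_jetComp hGr h𝔷s).sub (contDiff_jetComp hGr h𝔷's)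
    have hdom : ∀ m ≤ K, ∀ y, ‖iteratedFDeriv ℝ m (fun y ↦ jetComp Gr 𝔷 y - jetComp Gr 𝔷' y) y‖ ≤ Cdr * ∑ l ∈ Finset.range (m + 1), ‖iteratedFDeriv ℝ l (jetOf w) y‖ := by
      intro m hm y
      have h := hCdr h𝔷s h𝔷's h𝔷b h𝔷'b m hm y
      rwa [h𝔷w] at h
    refine (hCp hsm (contDiff_jetOf hws) hCdr0 hdom).trans ?_
    calc Cp * ENNReal.ofReal (Cdr ^ 2) * ∑ l ∈ Finset.range (K + 1), sobolevEnergy l (jetOf w) ≤ Cp * ENNReal.ofReal (Cdr ^ 2) * (Slow * X1) := mul_le_mul' le_rfl h𝔷E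
      _ = BC * X1 := by rw [hBC]; ring
  /- ## assembly -/
  obtain ⟨Tdiff, hTdiff⟩ : ∃ Tdiff : E' → W, Tdiff = fun y ↦ ∑ i, ∑ i', (φ i i' y • ψw i i' y + (φ i i' y - φ' i i' y) • ψ' i i' y) := ⟨_, rfl⟩
  have hpair : ∀ i i', ContDiff ℝ ∞ fun y ↦ φ i i' y • ψw i i' y + (φ i i' y - φ' i i' y) • ψ' i i' y := fun i i' ↦
    ((hφs i i').smul (hψws i i')).add (((hφs i i').sub (hφ's i i')).smul (hψ's i i'))
  have hTdiffs : ContDiff ℝ ∞ Tdiff := by rw [hTdiff]; exact ContDiff.sum fun i _ ↦ ContDiff.sum fun i' _ ↦ hpair i i'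
  have hTdiffE : sobolevEnergy K Tdiff ≤ cι * cι * (2 * (cι * cι) * ((2 * CA * ENNReal.ofReal ((Amax * Amax) ^ 2)) * ENNReal.ofReal (δ ^ 2) * X2 + (BA + BB) * X1)) := by
    have hterm : ∀ i i', sobolevEnergy K (fun y ↦ φ i i' y • ψw i i' y + (φ i i' y - φ' i i' y) • ψ' i i' y) ≤
        2 * ((2 * CA * ENNReal.ofReal ((Amax * Amax) ^ 2)) * ENNReal.ofReal (δ ^ 2) * X2 + (BA + BB) * X1) := by
      intro i i'
      refine (sobolevEnergy_add_le K (((hφs i i').smul (hψws i i')).of_le (by exact_mod_cast le_top))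
        ((((hφs i i').sub (hφ's i i')).smul (hψ's i i')).of_le (by exact_mod_cast le_top))).trans ?_
      calc 2 * sobolevEnergy K (fun y ↦ φ i i' y • ψw i i' y) + 2 * sobolevEnergy K (fun y ↦ (φ i i' y - φ' i i' y) • ψ' i i' y)
          ≤ 2 * ((2 * CA * ENNReal.ofReal ((Amax * Amax) ^ 2)) * ENNReal.ofReal (δ ^ 2) * X2 + BA * X1) + 2 * (BB * X1) :=
            add_le_add (mul_le_mul' le_rfl (hTA i i')) (mul_le_mul' le_rfl (hTB i i'))
        _ = _ := by ring
    have h1 := sobolevEnergy_sum_le_card K Finset.univ (f := fun i y ↦ ∑ i', (φ i i' y • ψw i i' y + (φ i i' y - φ' i i' y) • ψ' i i' y))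
      fun i _ ↦ (ContDiff.sum fun i' _ ↦ hpair i i').of_le (by exact_mod_cast le_top)
    rw [Finset.card_univ, ← hTdiff] at h1
    have h2 : ∀ i, sobolevEnergy K (fun y ↦ ∑ i', (φ i i' y • ψw i i' y + (φ i i' y - φ' i i' y) • ψ' i i' y)) ≤
        cι * ∑ i', sobolevEnergy K (fun y ↦ φ i i' y • ψw i i' y + (φ i i' y - φ' i i' y) • ψ' i i' y) := by
      intro i
      have h := sobolevEnergy_sum_le_card K Finset.univ (f := fun i' y ↦ φ i i' y • ψw i i' y + (φ i i' y - φ' i i' y) • ψ' i i' y)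
        fun i' _ ↦ (hpair i i').of_le (by exact_mod_cast le_top)
      rw [Finset.card_univ] at h
      exact h
    calc sobolevEnergy K Tdiff ≤ cι * ∑ i, (cι * ∑ i', sobolevEnergy K (fun y ↦ φ i i' y • ψw i i' y + (φ i i' y - φ' i i' y) • ψ' i i' y)) :=
          h1.trans (mul_le_mul' le_rfl (Finset.sum_le_sum fun i _ ↦ h2 i))
      _ ≤ cι * ∑ _i : ι, (cι * ∑ _i' : ι, (2 * ((2 * CA * ENNReal.ofReal ((Amax * Amax) ^ 2)) * ENNReal.ofReal (δ ^ 2) * X2 + (BA + BB) * X1))) :=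
          mul_le_mul' le_rfl (Finset.sum_le_sum fun i _ ↦ mul_le_mul' le_rfl (Finset.sum_le_sum fun i' _ ↦ hterm i i'))
      _ = _ := by rw [Finset.sum_const, Finset.sum_const, Finset.card_univ, nsmul_eq_mul, nsmul_eq_mul, hcι]; ring
  -- the difference of the flat sources
  have hcutb : ∀ y, |cut y| ≤ Mcut := fun y ↦ by
    have h := hMcut 0 (Nat.zero_le _) y
    rwa [norm_iteratedFDeriv_zero, Real.norm_eq_abs] at h
  have hcutw : ∀ l : List (Fin (Module.finrank ℝ E')), l ≠ [] → l.length ≤ K → ∀ y, ‖iterDirDeriv (l.map (stdOrthonormalBasis ℝ E')) cut y‖ ≤ Mcut := by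
    intro l _ hl y
    have h := norm_iterDirDeriv_le hcut (l.map (stdOrthonormalBasis ℝ E')) y
    have hprod : ∏ i, ‖(l.map (stdOrthonormalBasis ℝ E')).get i‖ = 1 := Finset.prod_eq_one fun i _ ↦ by simp [(stdOrthonormalBasis ℝ E').orthonormal.1]
    rw [hprod, mul_one, List.length_map] at h
    exact h.trans (hMcut _ hl y)
  have hinner : ContDiff ℝ ∞ fun y ↦ Tdiff y + (jetComp Gr 𝔷 y - jetComp Gr 𝔷' y) := hTdiffs.add ((contDiff_jetComp hGr h𝔷s).sub (contDiff_jetComp hGr h𝔷's))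
  have heq : (fun y ↦ thetaFlat Av cut Gc Gr g₀ z y - thetaFlat Av cut Gc Gr g₀ z' y) = fun y ↦ cut y • (Tdiff y + (jetComp Gr 𝔷 y - jetComp Gr 𝔷' y)) := by
    funext y
    have hsub' : ∀ i i', ψw i i' y = ψ i i' y - ψ' i i' y := fun i i' ↦ by rw [← hψsub i i']
    simp only [thetaFlat, hTdiff, hφ, hφ', hsub', jetComp_apply]
    simp only [hψ, hψ', h𝔷, h𝔷', jetOf_apply]
    simp only [smul_add, smul_sub, sub_smul, Finset.smul_sum, Finset.sum_add_distrib, Finset.sum_sub_distrib]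
    abel
  rw [heq]
  refine (hCcut hcut hinner hcutb hcutw).trans ?_
  refine (mul_le_mul' le_rfl (sobolevEnergy_add_le K (hTdiffs.of_le (by exact_mod_cast le_top))
    (((contDiff_jetComp hGr h𝔷s).sub (contDiff_jetComp hGr h𝔷's)).of_le (by exact_mod_cast le_top)))).trans ?_
  calc Ccut * ENNReal.ofReal (Mcut ^ 2) * (2 * sobolevEnergy K Tdiff + 2 * sobolevEnergy K (fun y ↦ jetComp Gr 𝔷 y - jetComp Gr 𝔷' y))
      ≤ Ccut * ENNReal.ofReal (Mcut ^ 2) * (2 * (cι * cι * (2 * (cι * cι) * ((2 * CA * ENNReal.ofReal ((Amax * Amax) ^ 2)) * ENNReal.ofReal (δ ^ 2) * X2 + (BA + BB) * X1))) +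
          2 * (BC * X1)) := mul_le_mul' le_rfl (add_le_add (mul_le_mul' le_rfl hTdiffE) (mul_le_mul' le_rfl hTC))
    _ = Ctop * ENNReal.ofReal (δ ^ 2) * X2 + B * X1 := by rw [hCtop, hB]; ring

end Theta

end Literature.Analysis.PDE
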